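import Literature.NumberTheory.ConnesMoscovici2022.UVProlateFourierTestVectors
import Literature.NumberTheory.ConnesMoscovici2022.UVProlateSymmetryAtInfinity
import Literature.NumberTheory.ConnesMoscovici2022.UVProlateQuotientBasisVectors
import Mathlib.Analysis.SpecialFunctions.Log.NegMulLog
import Mathlib.Analysis.Calculus.BumpFunction.FiniteDimension
import HarnessLib

/-!
# Connes–Moscovici 2022, Theorem 1.6 (i), Fourier clause — part 1: the `λ`-side of the converse
("orthogonality to `β_±` forces the boundary condition (1.19)") and Lemma 1.2's equality of the
lateral limits, for an ARBITRARY element of `dom W_max`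

LINE 1 — FRAMING. RH-FREE corpus literature (cell rh-crit, C1 Connes–Consani/Moscovici corpus,
row O2 `UVProlateSpectrum`; sequel material, no leaf / binder role in any route).
bears_on: LADDER-RH W-C/W-P.  WHAT THIS IS NOT: any claim about `ζ` or RH; nothing in this file
bears on the truth of RH.  Theorems only: 0 `def`s, 0 named facts, no `sorry`.

Source: A. Connes, H. Moscovici, *The UV prolate spectrum matches the zeros of zeta*, PNAS 119
(2022) [bib `ConnesMoscovici2022`] = arXiv:2112.05500, Lemma 2.2 (= PNAS Lemma 1.2) and the proof
of Theorem 2.6 (= PNAS Thm 1.6), chunks p0004:L50–L90 and p0006:L38–L50, L76–L85 of the held text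
`paper-arxiv-2112.05500`:

> "Lemma 2.2 … (ii) … the distribution `p ∂_x ξ` is an `L²`-function, which is continuous near `±λ`"
> "(2.16) `𝓛_β := ⋂ Ker L_{β±} ∩ ⋂ Ker L_{β̂±}` … Theorem 2.6 (i) `W_sa` is selfadjoint and
> commutes with the Fourier transform … its domain `𝓛_β` is invariant under the Fourier transform
> also by construction."

The tree DEFINES `𝓛_β = prolateSASet` by the explicit boundary conditions (1.19)–(1.21), so the
printed "by construction" (`𝓛_β` = joint kernel of the four boundary functionals `L_{β±}`,
`L_{β̂±} = L_{β±} ∘ 𝔽`) has to be EARNED: one must show that, for an arbitrary `ζ ∈ dom W_max`,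
the four orthogonality relations `⟪W_max ζ, τ⟫ = ⟪ζ, W_max τ⟫`, `τ ∈ {β_+, β_-, 𝓕β_+, 𝓕β_-}`,
imply (1.19)–(1.21).  This file does the `λ`-side half of that and the lateral-limit step:

* §A **a-priori bound** `p·g → 0` at `λ⁻` and `(−λ)⁺` for the regular representative `g` of ANY
  `ζ ∈ dom W_max` (`g′ = O(1/p)` near `±λ` ⇒ `g = O(log)`): `tendsto_pCoeff_mul_zero_nhdsLT_lam`,
  `tendsto_pCoeff_mul_zero_nhdsGT_neg_lam`;
* §B **the `λ`-side converse**: `⟪W_max ζ, β_+⟫ − ⟪ζ, W_max β_+⟫ = conj c_{−λ⁺} − conj c_{λ⁻}`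
  (`inner_sub_inner_betaPlus`) and `⟪W_max ζ, β_-⟫ − ⟪ζ, W_max β_-⟫ = −λ(conj c_{λ⁻} + conj c_{−λ⁺})`
  (`inner_sub_inner_betaMinus`, Green on `(−λ, λ)` against `θ(x) = x`, cc-t14 g3's
  `intervalIntegral_green_of_contDiffOn`), hence **`inner_limits_eq_zero`**: orthogonality to
  `β_±` forces the INNER one-sided limits `c_{λ⁻}, c_{−λ⁺}` of `p g′` to vanish; on the way the
  a.e. formulas `W_max β_+ = q·1_I`, `W_max β_- = (2x + qx)·1_I` (`prolateMax_betaPlus_coeFn`,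
  `prolateMax_betaMinus_coeFn`);
* §C **Lemma 1.2's equality of the lateral limits** (`lateral_limits_eq_lam`,
  `lateral_limits_eq_neg_lam`): for ANY `ζ ∈ dom W_max`, the one-sided limits of `p g′` at `λ`
  from inside and outside agree (and at `−λ`), by testing `⟪W_max ζ, θ⟫ = ⟪ζ, Wθ⟫` against a
  bump `θ ≡ 1` near the singular point (cc-t6 g4's `intervalIntegral_lagrange_pair`, cc-t8 g3's
  `intervalIntegral_eq_sub_of_boundary_tendsto`).

STATUS (end of seat t10 g3): §D–§E below were appended the same day — the `∞`-side toolkit, the defect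
as the pairing of asymptotic coefficients (`inner_sub_inner_eq_pairing`) and the ANALYTIC converse
`mem_prolateSASet_of_inner_beta_eq`; the inclusion `𝓕(𝓛_β) ⊆ 𝓛_β` itself and `CM22_thm_1_6_holds`
landed meanwhile in cc-t14 g4's `UVProlateThm16Holds` (algebraic route via self-adjointness, using
the leaf and the test-vector file of this seat).  Original road description: the `∞`-side — cc-t6 g4's
`intervalIntegral_symm_eq_boundaryForm` against `φ_± = 𝓕β_±` (`UVProlateFourierTestVectors`)
reads `BF(R) − BF(−R) = −(2/π)(1 − λ²/R²)·conj((1.20)-expression of ζ⁺ at R)` for `φ_+` and the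
(1.21)-expression of `ζ⁻` for `φ_-` up to terms killed by cc-t14 g3's `exists_asymptotics_atTop_of_ftc`;
with `Ω(𝓕ξ, τ) = Ω(ξ, 𝓕⁻¹τ)` (`omegaForm_fourierL2_left`, leaf `UVProlateMaxDomainFourier`) and
`Ω ≡ 0` on `𝓛_β` (cc-t6 g4 `inner_prolateMax_symm`) this assembles `fourierL2_mem_prolateSASet`,
`IsProlateSA.commutesWith_fourierL2` (Thm 1.6 (i), Fourier clause) and, from cc-t14 g3's
`CM22_thm_1_6_ii_cutoffProj`, `IsProlateSA.commutesWith_cutoffProjHat` (Thm 1.6 (ii), `P̂_λ`).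
-/

noncomputable section

open Complex Set MeasureTheory Filter Topology SchwartzMap FourierTransform intervalIntegral
open scoped Real Topology ENNReal InnerProductSpace

namespace Literature.NumberTheory.ConnesMoscovici2022

open Literature.NumberTheory.ConnesConsani2021 Literature.Analysis.OperatorTheory

variable {lam : ℝ}

/-! ## §0. Helpers -/

/-- The open set `{x ≠ ±λ}`. [folklore] -/
private theorem isOpen_U' (lam : ℝ) : IsOpen {x : ℝ | x ≠ lam ∧ x ≠ -lam} := isOpen_ne.and isOpen_ne

/-! ## §A. The a-priori bound: `p·g → 0` at `±λ` for every element of `dom W_max` -/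

/-- **One-sided estimate at a right endpoint.** If `g ∈ C¹(a,b)` and `‖g′(x)‖ ≤ K/(b − x)` on
`(a, b)`, then `(b − x)·g(x) → 0` at `b⁻` (`g` grows at most logarithmically).  This is the
growth of a general `dom W_max` element at the regular singular points `±λ` (the distribution
`p∂ξ` is a bounded function there, Lemma 1.2). [cite: ConnesMoscovici2022, Lemma 1.2 (= arXiv:2112.05500 Lemma 2.2, chunk p0004:L50–L52)] -/
theorem tendsto_sub_mul_zero_of_norm_deriv_le {a b K : ℝ} (hab : a < b) {g : ℝ → ℂ}
    (hg : ContDiffOn ℝ 1 g (Ioo a b)) (hd : ∀ x ∈ Ioo a b, ‖deriv g x‖ ≤ K / (b - x)) :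
    Tendsto (fun x ↦ ((b - x : ℝ) : ℂ) * g x) (𝓝[<] b) (𝓝 0) := by
  have hgd : ∀ x ∈ Ioo a b, HasDerivAt g (deriv g x) x := fun x hx ↦
    ((hg.differentiableOn one_ne_zero x hx).differentiableAt (Ioo_mem_nhds hx.1 hx.2)).hasDerivAt
  have hg'c : ContinuousOn (deriv g) (Ioo a b) := hg.continuousOn_deriv_of_isOpen isOpen_Ioo le_rfl
  set x₁ : ℝ := (a + b) / 2 with hx₁
  have hx₁m : x₁ ∈ Ioo a b := ⟨left_lt_add_div_two.2 hab, add_div_two_lt_right.2 hab⟩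
  -- the logarithmic bound on `[x₁, b)`
  have hbound : ∀ x ∈ Ico x₁ b, ‖g x‖ ≤ ‖g x₁‖ + K * (Real.log (b - x₁) - Real.log (b - x)) := by
    intro x hx
    have hsub : uIcc x₁ x ⊆ Ioo a b := by
      rw [uIcc_of_le hx.1]; exact fun t ht ↦ ⟨hx₁m.1.trans_le ht.1, ht.2.trans_lt hx.2⟩
    have hFTC : ∫ t in x₁..x, deriv g t = g x - g x₁ :=
      integral_eq_sub_of_hasDerivAt (fun t ht ↦ hgd t (hsub ht)) ((hg'c.mono hsub).intervalIntegrable)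
    have hgx : g x = g x₁ + ∫ t in x₁..x, deriv g t := by rw [hFTC]; ring
    -- `∫_{x₁}^x K/(b−t) dt = K (log(b−x₁) − log(b−x))`
    have hprim : ∀ t ∈ uIcc x₁ x, HasDerivAt (fun s ↦ -K * Real.log (b - s)) (K / (b - t)) t := by
      intro t ht
      have hbt : b - t ≠ 0 := (sub_pos.2 (hsub ht).2).ne'
      have h1 : HasDerivAt (fun s ↦ b - s) (-1) t := by simpa using (hasDerivAt_id t).const_sub b
      have h2 : HasDerivAt (fun s ↦ -K * Real.log (b - s)) (-K * (-1 / (b - t))) t :=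
        (h1.log hbt).const_mul (-K)
      exact h2.congr_deriv (by ring)
    have hcontK : ContinuousOn (fun t ↦ K / (b - t)) (uIcc x₁ x) :=
      continuousOn_const.div (continuousOn_const.sub continuousOn_id)
        fun t ht ↦ (sub_pos.2 (hsub ht).2).ne'
    have hintK : ∫ t in x₁..x, K / (b - t) = -K * Real.log (b - x) - -K * Real.log (b - x₁) :=
      integral_eq_sub_of_hasDerivAt hprim (hcontK.intervalIntegrable)
    have hnorm : ‖∫ t in x₁..x, deriv g t‖ ≤ ∫ t in x₁..x, K / (b - t) := by
      refine intervalIntegral.norm_integral_le_of_norm_le hx.1 ?_ hcontK.intervalIntegrable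
      exact ae_of_all _ fun t ht ↦ hd t (hsub (by rw [uIcc_of_le hx.1]; exact ⟨ht.1.le, ht.2⟩))
    calc ‖g x‖ = ‖g x₁ + ∫ t in x₁..x, deriv g t‖ := by rw [← hgx]
      _ ≤ ‖g x₁‖ + ‖∫ t in x₁..x, deriv g t‖ := norm_add_le _ _
      _ ≤ ‖g x₁‖ + K * (Real.log (b - x₁) - Real.log (b - x)) := by
          rw [hintK] at hnorm; linarith
  -- `(b − x)·(‖g x₁‖ + K (log(b−x₁) − log(b−x))) → 0`
  have hlim : Tendsto (fun x ↦ (b - x) * (‖g x₁‖ + K * (Real.log (b - x₁) - Real.log (b - x))))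
      (𝓝[<] b) (𝓝 0) := by
    have hbx : Tendsto (fun x : ℝ ↦ b - x) (𝓝[<] b) (𝓝 0) := by
      have hc : Continuous fun x : ℝ ↦ b - x := continuous_const.sub continuous_id
      have := (hc.tendsto b).mono_left (nhdsWithin_le_nhds (s := Iio b))
      simpa using this
    have hml : Tendsto (fun x : ℝ ↦ (b - x) * Real.log (b - x)) (𝓝[<] b) (𝓝 0) := by
      have := (Real.continuous_mul_log.tendsto 0).comp hbx
      rw [zero_mul] at this
      exact this
    have h := (hbx.mul_const (‖g x₁‖ + K * Real.log (b - x₁))).sub (hml.const_mul K)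
    simp only [zero_mul, mul_zero, sub_zero] at h
    refine h.congr fun x ↦ ?_
    ring
  rw [tendsto_zero_iff_norm_tendsto_zero]
  refine squeeze_zero_norm' ?_ hlim
  filter_upwards [Ioo_mem_nhdsLT hx₁m.2] with x hx
  rw [norm_norm, norm_mul, Complex.norm_real, Real.norm_eq_abs, abs_of_pos (sub_pos.2 hx.2)]
  exact mul_le_mul_of_nonneg_left (hbound x ⟨hx.1.le, hx.2⟩) (sub_pos.2 hx.2).le

/-- **One-sided estimate at a left endpoint** (mirror of the previous lemma): `‖g′(x)‖ ≤ K/(x − a)`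
on `(a,b)` gives `(x − a)·g(x) → 0` at `a⁺`. [cite: ConnesMoscovici2022, Lemma 1.2 (= arXiv:2112.05500 Lemma 2.2, chunk p0004:L50–L52)] -/
theorem tendsto_sub_mul_zero_of_norm_deriv_le' {a b K : ℝ} (hab : a < b) {g : ℝ → ℂ}
    (hg : ContDiffOn ℝ 1 g (Ioo a b)) (hd : ∀ x ∈ Ioo a b, ‖deriv g x‖ ≤ K / (x - a)) :
    Tendsto (fun x ↦ ((x - a : ℝ) : ℂ) * g x) (𝓝[>] a) (𝓝 0) := by
  -- reflect: `h(t) = g(−t)` on `(−b, −a)` with `‖h′(t)‖ ≤ K/((−a) − t)`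
  set h : ℝ → ℂ := fun t ↦ g (-t) with hh
  have hmaps : MapsTo (fun t : ℝ ↦ -t) (Ioo (-b) (-a)) (Ioo a b) := fun t ht ↦ by
    simp only [mem_Ioo] at ht ⊢; constructor <;> linarith
  have hhc : ContDiffOn ℝ 1 h (Ioo (-b) (-a)) := hg.comp contDiff_neg.contDiffOn hmaps
  have hhd : ∀ t ∈ Ioo (-b) (-a), ‖deriv h t‖ ≤ K / (-a - t) := by
    intro t ht
    rw [hh, deriv_comp_neg, norm_neg]
    have := hd (-t) (hmaps ht)
    have e : (-t - a) = (-a - t) := by ring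
    rw [e] at this
    exact this
  have H := tendsto_sub_mul_zero_of_norm_deriv_le (a := -b) (b := -a) (by linarith) hhc hhd
  -- transport back along `x = −t`
  have hneg : Tendsto (fun x : ℝ ↦ -x) (𝓝[>] a) (𝓝[<] (-a)) := by
    have h1 : Tendsto (fun x : ℝ ↦ -x) (𝓝 a) (𝓝 (-a)) := (continuous_neg.tendsto a)
    refine h1.inf ?_
    rw [tendsto_principal_principal]
    intro x (hx : a < x)
    show -x < -a
    linarith
  have := H.comp hneg
  refine this.congr fun x ↦ ?_
  show ((-a - -x : ℝ) : ℂ) * g (- -x) = ((x - a : ℝ) : ℂ) * g x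
  rw [neg_neg]; congr 1; push_cast; ring

/-- `p = (λ − x)(λ + x)`. [folklore] -/
private theorem pCoeff_eq_mul (lam x : ℝ) : pCoeff lam x = ((lam - x : ℝ) : ℂ) * ((lam + x : ℝ) : ℂ) := by
  simp only [pCoeff]; push_cast; ring

/-- **`p·g → 0` at `λ⁻`** for the regular representative of any `ξ ∈ dom W_max` (only the
existence of the one-sided limit of `p g′` is used). [cite: ConnesMoscovici2022, Lemma 1.2 (= arXiv:2112.05500 Lemma 2.2, chunk p0004:L50–L52)] -/
theorem tendsto_pCoeff_mul_zero_nhdsLT_lam (hlam : 0 < lam) {g : ℝ → ℂ}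
    (hg : ContDiffOn ℝ 1 g {x | x ≠ lam ∧ x ≠ -lam}) {c : ℂ}
    (hc : Tendsto (fun x ↦ pCoeff lam x * deriv g x) (𝓝[<] lam) (𝓝 c)) :
    Tendsto (fun x ↦ pCoeff lam x * g x) (𝓝[<] lam) (𝓝 0) := by
  -- a bound `‖p g′‖ ≤ M` on some `(l, λ)` with `0 < l`
  have hev : ∀ᶠ x in 𝓝[<] lam, ‖pCoeff lam x * deriv g x‖ < ‖c‖ + 1 :=
    hc.norm.eventually (gt_mem_nhds (lt_add_one _))
  have hev' : ∀ᶠ x in 𝓝[<] lam, ‖pCoeff lam x * deriv g x‖ < ‖c‖ + 1 ∧ x ∈ Ioo 0 lam :=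
    hev.and (Ioo_mem_nhdsLT hlam)
  obtain ⟨l, hl, hlsub⟩ := (mem_nhdsLT_iff_exists_Ioo_subset).1 hev'
  set l' : ℝ := max l 0 with hl'
  have hl'lam : l' < lam := max_lt hl hlam
  have hsubU : Ioo l' lam ⊆ {x | x ≠ lam ∧ x ≠ -lam} := fun x hx ↦
    ⟨hx.2.ne, by have : 0 ≤ l' := le_max_right _ _; intro h; linarith [hx.1]⟩
  have hgI : ContDiffOn ℝ 1 g (Ioo l' lam) := hg.mono hsubU
  have hd : ∀ x ∈ Ioo l' lam, ‖deriv g x‖ ≤ ((‖c‖ + 1) / lam) / (lam - x) := by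
    intro x hx
    have hxl : x ∈ Ioo l lam := ⟨(le_max_left _ _).trans_lt hx.1, hx.2⟩
    obtain ⟨hb, hx0⟩ := hlsub hxl
    have hpx : ‖pCoeff lam x‖ = (lam - x) * (lam + x) := by
      rw [pCoeff_eq_mul, norm_mul, Complex.norm_real, Complex.norm_real, Real.norm_eq_abs,
        Real.norm_eq_abs, abs_of_pos (by linarith [hx.2]), abs_of_pos (by linarith [hx0.1])]
    have hlx : lam ≤ lam + x := by linarith [hx0.1]
    have h1 : (lam - x) * lam * ‖deriv g x‖ ≤ ‖c‖ + 1 := by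
      calc (lam - x) * lam * ‖deriv g x‖ ≤ (lam - x) * (lam + x) * ‖deriv g x‖ := by
            exact mul_le_mul_of_nonneg_right
              (mul_le_mul_of_nonneg_left (by linarith [hx0.1]) (by linarith [hx.2])) (norm_nonneg _)
        _ = ‖pCoeff lam x * deriv g x‖ := by rw [norm_mul, hpx]
        _ ≤ ‖c‖ + 1 := hb.le
    rw [le_div_iff₀ (by linarith [hx.2]), le_div_iff₀ hlam]
    linarith
  have H := tendsto_sub_mul_zero_of_norm_deriv_le hl'lam hgI hd
  -- `p g = (λ + x)·((λ − x) g)`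
  have hcont : Tendsto (fun x : ℝ ↦ ((lam + x : ℝ) : ℂ)) (𝓝[<] lam) (𝓝 ((lam + lam : ℝ) : ℂ)) :=
    ((continuous_ofReal.comp (continuous_const.add continuous_id)).tendsto lam).mono_left
      nhdsWithin_le_nhds
  have := hcont.mul H
  rw [mul_zero] at this
  refine this.congr fun x ↦ ?_
  rw [pCoeff_eq_mul]; ring

/-- **`p·g → 0` at `(−λ)⁺`** for the regular representative of any `ξ ∈ dom W_max`.
[cite: ConnesMoscovici2022, Lemma 1.2 (= arXiv:2112.05500 Lemma 2.2, chunk p0004:L50–L52)] -/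
theorem tendsto_pCoeff_mul_zero_nhdsGT_neg_lam (hlam : 0 < lam) {g : ℝ → ℂ}
    (hg : ContDiffOn ℝ 1 g {x | x ≠ lam ∧ x ≠ -lam}) {c : ℂ}
    (hc : Tendsto (fun x ↦ pCoeff lam x * deriv g x) (𝓝[>] (-lam)) (𝓝 c)) :
    Tendsto (fun x ↦ pCoeff lam x * g x) (𝓝[>] (-lam)) (𝓝 0) := by
  have hev : ∀ᶠ x in 𝓝[>] (-lam), ‖pCoeff lam x * deriv g x‖ < ‖c‖ + 1 :=
    hc.norm.eventually (gt_mem_nhds (lt_add_one _))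
  have hev' : ∀ᶠ x in 𝓝[>] (-lam), ‖pCoeff lam x * deriv g x‖ < ‖c‖ + 1 ∧ x ∈ Ioo (-lam) 0 :=
    hev.and (Ioo_mem_nhdsGT (by linarith))
  obtain ⟨u, hu, husub⟩ := (mem_nhdsGT_iff_exists_Ioo_subset).1 hev'
  set u' : ℝ := min u 0 with hu'
  have hu'lam : -lam < u' := lt_min hu (by linarith)
  have hsubU : Ioo (-lam) u' ⊆ {x | x ≠ lam ∧ x ≠ -lam} := fun x hx ↦
    ⟨by have : u' ≤ 0 := min_le_right _ _; intro h; linarith [hx.2], hx.1.ne'⟩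
  have hgI : ContDiffOn ℝ 1 g (Ioo (-lam) u') := hg.mono hsubU
  have hd : ∀ x ∈ Ioo (-lam) u', ‖deriv g x‖ ≤ ((‖c‖ + 1) / lam) / (x - -lam) := by
    intro x hx
    have hxu : x ∈ Ioo (-lam) u := ⟨hx.1, hx.2.trans_le (min_le_left _ _)⟩
    obtain ⟨hb, hx0⟩ := husub hxu
    have hpx : ‖pCoeff lam x‖ = (lam - x) * (lam + x) := by
      rw [pCoeff_eq_mul, norm_mul, Complex.norm_real, Complex.norm_real, Real.norm_eq_abs,
        Real.norm_eq_abs, abs_of_pos (by linarith [hx0.2]), abs_of_pos (by linarith [hx.1])]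
    have h1 : (x - -lam) * lam * ‖deriv g x‖ ≤ ‖c‖ + 1 := by
      calc (x - -lam) * lam * ‖deriv g x‖ ≤ (lam - x) * (lam + x) * ‖deriv g x‖ := by
            have e : (x - -lam) * lam = (lam + x) * lam := by ring
            rw [e, mul_comm (lam - x) (lam + x)]
            exact mul_le_mul_of_nonneg_right
              (mul_le_mul_of_nonneg_left (by linarith [hx0.2]) (by linarith [hx.1])) (norm_nonneg _)
        _ = ‖pCoeff lam x * deriv g x‖ := by rw [norm_mul, hpx]
        _ ≤ ‖c‖ + 1 := hb.le
    rw [le_div_iff₀ (by linarith [hx.1]), le_div_iff₀ hlam]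
    linarith
  have H := tendsto_sub_mul_zero_of_norm_deriv_le' hu'lam hgI hd
  have hcont : Tendsto (fun x : ℝ ↦ ((lam - x : ℝ) : ℂ)) (𝓝[>] (-lam)) (𝓝 ((lam - -lam : ℝ) : ℂ)) :=
    ((continuous_ofReal.comp (continuous_const.sub continuous_id)).tendsto (-lam)).mono_left
      nhdsWithin_le_nhds
  have := hcont.mul H
  rw [mul_zero] at this
  refine this.congr fun x ↦ ?_
  rw [pCoeff_eq_mul]; push_cast; ring

/-! ## §B. The `λ`-side: orthogonality to `β_±` forces the inner limits of `p g′` to vanish -/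

section LamSide

/-- `star p = p`, `star q = q`. [folklore] -/
private theorem star_pCoeff' (lam x : ℝ) : star (pCoeff lam x) = pCoeff lam x := by
  rw [pCoeff]; exact Complex.conj_ofReal _

/-- `star q = q`. [folklore] -/
private theorem star_qCoeff' (lam x : ℝ) : star (qCoeff lam x) = qCoeff lam x := by
  rw [qCoeff]; exact Complex.conj_ofReal _

/-- Conjugation commutes with the interval integral. [folklore] -/
private theorem star_intervalIntegral' {f : ℝ → ℂ} {x y : ℝ} (hxy : x ≤ y) :
    star (∫ t in x..y, f t) = ∫ t in x..y, star (f t) := by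
  rw [intervalIntegral.integral_of_le hxy, intervalIntegral.integral_of_le hxy,
    ← starRingEnd_apply, ← integral_conj]
  rfl

/-- A.e. no point is `±λ`. [folklore] -/
private theorem ae_ne_two (lam : ℝ) : ∀ᵐ x : ℝ, x ≠ lam ∧ x ≠ -lam := by
  have h : ∀ a : ℝ, ∀ᵐ x : ℝ, x ≠ a := fun a ↦ by
    have : (volume : Measure ℝ) {a} = 0 := measure_singleton a
    filter_upwards [measure_eq_zero_iff_ae_notMem.1 this] with x hx
    simpa using hx
  filter_upwards [h lam, h (-lam)] with x h2 h3
  exact ⟨h2, h3⟩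

/-- `star ∘ f ∈ L²` for `f ∈ L²`. [folklore] -/
private theorem memLp_two_star' {f : ℝ → ℂ} (hf : MemLp f 2 volume) :
    MemLp (fun t ↦ star (f t)) 2 volume := by
  have hm : AEStronglyMeasurable (fun t ↦ star (f t)) volume :=
    continuous_star.comp_aestronglyMeasurable hf.1
  rw [memLp_two_iff_integrable_sq_norm hm]
  simpa [norm_star] using (memLp_two_iff_integrable_sq_norm hf.1).1 hf

/-- The symmetry-defect density is integrable. [folklore] -/
private theorem integrable_F' {ξ₁ ξ₂ η₁ η₂ : L2R} {g₁ g₂ : ℝ → ℂ}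
    (hae₁ : ((ξ₁ : ℝ → ℂ)) =ᵐ[volume] g₁) (hae₂ : ((ξ₂ : ℝ → ℂ)) =ᵐ[volume] g₂) :
    Integrable (fun t ↦ star ((η₁ : ℝ → ℂ) t) * g₂ t - star (g₁ t) * (η₂ : ℝ → ℂ) t) := by
  have hg₁ : MemLp g₁ 2 volume := (Lp.memLp ξ₁).ae_eq hae₁
  have hg₂ : MemLp g₂ 2 volume := (Lp.memLp ξ₂).ae_eq hae₂
  have h1 : Integrable ((fun t ↦ star ((η₁ : ℝ → ℂ) t)) * g₂) :=
    (memLp_two_star' (Lp.memLp η₁)).integrable_mul hg₂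
  have h2 : Integrable ((fun t ↦ star (g₁ t)) * fun t ↦ ((η₂ : ℝ → ℂ)) t) :=
    (memLp_two_star' hg₁).integrable_mul (Lp.memLp η₂)
  exact h1.sub h2

/-- The two indicators agree off `{±λ}`. [folklore] -/
private theorem indicator_Ioo_eq_Icc_of_ne' {x : ℝ} (hx : x ≠ lam ∧ x ≠ -lam) (f : ℝ → ℂ) :
    (Ioo (-lam) lam).indicator f x = (Icc (-lam) lam).indicator f x := by
  by_cases h : x ∈ Ioo (-lam) lam
  · rw [indicator_of_mem h, indicator_of_mem (Ioo_subset_Icc_self h)]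
  · have h' : x ∉ Icc (-lam) lam := fun h'' ↦
      h ⟨lt_of_le_of_ne h''.1 (Ne.symm hx.2), lt_of_le_of_ne h''.2 hx.1⟩
    rw [indicator_of_notMem h', indicator_of_notMem h]

/-- **`W f_+ = q` near `I`**: for `|x| < 2λ`, `(W f_+)(x) = q(x)` (`f_+ ≡ 1` there).
[cite: ConnesMoscovici2022, Lemma 1.5 setup (= arXiv:2112.05500 chunk p0005:L86)] -/
theorem prolateSchwartz_testBump (hlam : 0 < lam) {x : ℝ} (hx : |x| < 2 * lam) :
    prolateSchwartz lam (testBump lam hlam) x = qCoeff lam x := by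
  rw [prolateSchwartz_apply']
  have hnb : ∀ᶠ t in 𝓝 x, |t| < 2 * lam :=
    continuous_abs.continuousAt.preimage_mem_nhds (Iio_mem_nhds hx)
  have hev : (⇑(testBump lam hlam) : ℝ → ℂ) =ᶠ[𝓝 x] fun _ ↦ (1 : ℂ) := by
    filter_upwards [hnb] with t ht
    rw [testBump_apply, testBumpFun_eq_one hlam ht.le]
  have hd : ∀ᶠ t in 𝓝 x, deriv (⇑(testBump lam hlam)) t = 0 := by
    filter_upwards [hev.eventuallyEq_nhds] with t ht
    rw [ht.deriv_eq, deriv_const]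
  have hpd : (fun t ↦ pCoeff lam t * deriv (⇑(testBump lam hlam)) t) =ᶠ[𝓝 x] fun _ ↦ (0 : ℂ) := by
    filter_upwards [hd] with t ht
    rw [ht, mul_zero]
  rw [hpd.deriv_eq, deriv_const, neg_zero, zero_add, testBump_apply, testBumpFun_eq_one hlam hx.le,
    mul_one]

/-- **`W f_- = 2x + q x` near `I`**: for `|x| < 2λ`, `(W f_-)(x) = −(p)′ + q x = 2x + q(x) x`.
[cite: ConnesMoscovici2022, Lemma 1.5 setup (= arXiv:2112.05500 chunk p0005:L88)] -/
theorem prolateSchwartz_testBumpX (hlam : 0 < lam) {x : ℝ} (hx : |x| < 2 * lam) :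
    prolateSchwartz lam (testBumpX lam hlam) x = 2 * (x : ℂ) + qCoeff lam x * x := by
  rw [prolateSchwartz_apply']
  have hnb : ∀ᶠ t in 𝓝 x, |t| < 2 * lam :=
    continuous_abs.continuousAt.preimage_mem_nhds (Iio_mem_nhds hx)
  have hev : (⇑(testBumpX lam hlam) : ℝ → ℂ) =ᶠ[𝓝 x] fun t : ℝ ↦ (t : ℂ) := by
    filter_upwards [hnb] with t ht
    rw [testBumpX_apply, testBumpFun_eq_one hlam ht.le, mul_one]
  have hid : ∀ t : ℝ, deriv (fun s : ℝ ↦ (s : ℂ)) t = 1 := fun t ↦ by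
    simpa using ((hasDerivAt_id t).ofReal_comp).deriv
  have hd : ∀ᶠ t in 𝓝 x, deriv (⇑(testBumpX lam hlam)) t = 1 := by
    filter_upwards [hev.eventuallyEq_nhds] with t ht
    rw [ht.deriv_eq, hid]
  have hpd : (fun t ↦ pCoeff lam t * deriv (⇑(testBumpX lam hlam)) t) =ᶠ[𝓝 x] pCoeff lam := by
    filter_upwards [hd] with t ht
    rw [ht, mul_one]
  rw [hpd.deriv_eq, (hasDerivAt_pCoeff_def lam x).deriv, testBumpX_apply,
    testBumpFun_eq_one hlam hx.le, mul_one]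
  push_cast; ring

/-- **`W_max β_+ = q·1_I` a.e.** [cite: ConnesMoscovici2022, Lemma 1.3 (= arXiv:2112.05500 chunk p0004:L106–L120)] -/
theorem prolateMax_betaPlus_coeFn (hlam : 0 < lam) :
    ((prolateMax lam ⟨betaPlus lam hlam, (betaPlus_mem_prolateMax hlam).1⟩ : L2R) : ℝ → ℂ)
      =ᵐ[volume] (Icc (-lam) lam).indicator (qCoeff lam) := by
  obtain ⟨h, h'⟩ := betaPlus_mem_prolateMax hlam
  rw [h']
  have h2 : ((schwartzToL2 (prolateSchwartz lam (testBump lam hlam)) : L2R) : ℝ → ℂ) =ᵐ[volume]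
      prolateSchwartz lam (testBump lam hlam) :=
    (prolateSchwartz lam (testBump lam hlam)).coeFn_toLp 2 volume
  filter_upwards [cutoffProj_coeFn lam (schwartzToL2 (prolateSchwartz lam (testBump lam hlam))), h2]
    with x hx hx2
  rw [hx]
  by_cases hxI : x ∈ Icc (-lam) lam
  · rw [indicator_of_mem hxI, indicator_of_mem hxI]
    change ((schwartzToL2 (prolateSchwartz lam (testBump lam hlam)) : L2R) : ℝ → ℂ) x = _
    rw [hx2, prolateSchwartz_testBump hlam (by rw [abs_lt]; constructor <;> linarith [hxI.1, hxI.2])]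
  · rw [indicator_of_notMem hxI, indicator_of_notMem hxI]

/-- **`W_max β_- = (2x + q x)·1_I` a.e.** [cite: ConnesMoscovici2022, Lemma 1.3 (= arXiv:2112.05500 chunk p0004:L106–L120)] -/
theorem prolateMax_betaMinus_coeFn (hlam : 0 < lam) :
    ((prolateMax lam ⟨betaMinus lam hlam, (betaMinus_mem_prolateMax hlam).1⟩ : L2R) : ℝ → ℂ)
      =ᵐ[volume] (Icc (-lam) lam).indicator fun x : ℝ ↦ 2 * (x : ℂ) + qCoeff lam x * x := by
  obtain ⟨h, h'⟩ := betaMinus_mem_prolateMax hlam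
  rw [h']
  have h2 : ((schwartzToL2 (prolateSchwartz lam (testBumpX lam hlam)) : L2R) : ℝ → ℂ) =ᵐ[volume]
      prolateSchwartz lam (testBumpX lam hlam) :=
    (prolateSchwartz lam (testBumpX lam hlam)).coeFn_toLp 2 volume
  filter_upwards [cutoffProj_coeFn lam (schwartzToL2 (prolateSchwartz lam (testBumpX lam hlam))), h2]
    with x hx hx2
  rw [hx]
  by_cases hxI : x ∈ Icc (-lam) lam
  · rw [indicator_of_mem hxI, indicator_of_mem hxI]
    change ((schwartzToL2 (prolateSchwartz lam (testBumpX lam hlam)) : L2R) : ℝ → ℂ) x = _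
    rw [hx2, prolateSchwartz_testBumpX hlam (by rw [abs_lt]; constructor <;> linarith [hxI.1, hxI.2])]
  · rw [indicator_of_notMem hxI, indicator_of_notMem hxI]

variable {ζ : L2R} {g : ℝ → ℂ}

/-- `[x, y] ⊆ (−λ, λ)` lies in `{x ≠ ±λ}`. [folklore] -/
private theorem Icc_subset_U_of_mem_Ioo {x y : ℝ} (hx : x ∈ Ioo (-lam) lam) (hy : y ∈ Ioo (-lam) lam) :
    Icc x y ⊆ {t : ℝ | t ≠ lam ∧ t ≠ -lam} := fun _ ht ↦
  ⟨(ht.2.trans_lt hy.2).ne, (hx.1.trans_le ht.1).ne'⟩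

/-- A whole-line integral of a function a.e. supported in `(−λ, λ)` is the interval integral. [folklore] -/
private theorem integral_eq_intervalIntegral_of_support (hlam : 0 < lam) {F : ℝ → ℂ}
    (hF : F =ᵐ[volume] (Ioo (-lam) lam).indicator F) :
    ∫ t, F t = ∫ t in (-lam)..lam, F t := by
  rw [integral_congr_ae hF, MeasureTheory.integral_indicator measurableSet_Ioo,
    intervalIntegral.integral_of_le (by linarith), integral_Ioc_eq_integral_Ioo]

/-- **`⟪W_max ζ, β_+⟫ − ⟪ζ, W_max β_+⟫ = conj c_{−λ⁺} − conj c_{λ⁻}`** for every `ζ ∈ dom W_max` with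
regular representative `g` (`c_{λ⁻}, c_{−λ⁺}` the INNER one-sided limits of `p g′`): the pairing
with `β_+ = 1_I` reads off the inner boundary values (FTC form of `(p g′)′ = q g − W_max ζ` on
`(−λ, λ)`). [cite: ConnesMoscovici2022, Lemma 1.5 and proof of Thm 1.6 (= arXiv:2112.05500 chunks p0005:L84–L110, p0006:L83–L85)] -/
theorem inner_sub_inner_betaPlus (hlam : 0 < lam) (hζ : ζ ∈ (prolateMax lam).domain)
    (hae : ((ζ : ℝ → ℂ)) =ᵐ[volume] g)
    (hftc : ∀ x y, x ≤ y → Icc x y ⊆ {x | x ≠ lam ∧ x ≠ -lam} →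
      pCoeff lam y * deriv g y - pCoeff lam x * deriv g x =
        ∫ t in x..y, (qCoeff lam t * g t - (prolateMax lam ⟨ζ, hζ⟩ : L2R) t))
    {cL cR : ℂ} (hcL : Tendsto (fun x ↦ pCoeff lam x * deriv g x) (𝓝[<] lam) (𝓝 cL))
    (hcR : Tendsto (fun x ↦ pCoeff lam x * deriv g x) (𝓝[>] (-lam)) (𝓝 cR)) :
    ⟪(prolateMax lam ⟨ζ, hζ⟩ : L2R), betaPlus lam hlam⟫_ℂ -
      ⟪ζ, (prolateMax lam ⟨betaPlus lam hlam, (betaPlus_mem_prolateMax hlam).1⟩ : L2R)⟫_ℂ =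
      star cR - star cL := by
  set η : L2R := prolateMax lam ⟨ζ, hζ⟩ with hηdef
  set η₂ : L2R := prolateMax lam ⟨betaPlus lam hlam, (betaPlus_mem_prolateMax hlam).1⟩ with hη₂def
  set g₂ : ℝ → ℂ := (Ioo (-lam) lam).indicator fun _ ↦ (1 : ℂ) with hg₂def
  have hae₂ : ((betaPlus lam hlam : L2R) : ℝ → ℂ) =ᵐ[volume] g₂ := by
    filter_upwards [betaPlus_coeFn hlam, ae_ne_two lam] with t ht hne
    rw [ht, hg₂def, indicator_Ioo_eq_Icc_of_ne' hne]
  have hη₂ := prolateMax_betaPlus_coeFn hlam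
  rw [← integral_F_eq_inner_sub (η₁ := η) (η₂ := η₂) hae hae₂]
  set F : ℝ → ℂ := fun t ↦ star ((η : ℝ → ℂ) t) * g₂ t - star (g t) * (η₂ : ℝ → ℂ) t with hFdef
  have hFsupp : F =ᵐ[volume] (Ioo (-lam) lam).indicator F := by
    filter_upwards [hη₂, ae_ne_two lam] with t ht hne
    by_cases htI : t ∈ Ioo (-lam) lam
    · rw [indicator_of_mem htI]
    · rw [indicator_of_notMem htI, hFdef]
      simp only
      rw [ht, ← indicator_Ioo_eq_Icc_of_ne' hne, hg₂def, indicator_of_notMem htI,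
        indicator_of_notMem htI, mul_zero, mul_zero, sub_zero]
  rw [integral_eq_intervalIntegral_of_support hlam hFsupp]
  have hFi : Integrable F := integrable_F' (η₁ := η) (η₂ := η₂) hae hae₂
  have hstar : Continuous (star : ℂ → ℂ) := continuous_star
  have H := intervalIntegral_eq_sub_of_boundary_tendsto (by linarith : -lam < lam) hFi.intervalIntegrable
    (B := fun s ↦ -star (pCoeff lam s * deriv g s)) (La := -star cR) (Lb := -star cL) ?_ ?_ ?_
  · rw [H]; ring
  · intro x hx y hy hxy
    have hIU := Icc_subset_U_of_mem_Ioo hx hy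
    have h1 : ∫ t in x..y, F t = ∫ t in x..y, star (qCoeff lam t * g t - (η : ℝ → ℂ) t) * (-1) := by
      refine intervalIntegral.integral_congr_ae ?_
      filter_upwards [hη₂] with t ht htI
      rw [uIoc_of_le hxy] at htI
      have htIoo : t ∈ Ioo (-lam) lam := ⟨hx.1.trans htI.1, htI.2.trans_lt hy.2⟩
      rw [hFdef]
      simp only
      rw [ht, hg₂def, indicator_of_mem htIoo, indicator_of_mem (Ioo_subset_Icc_self htIoo),
        star_sub, star_mul', star_qCoeff']
      ring
    rw [h1, intervalIntegral.integral_mul_const, ← star_intervalIntegral' hxy, ← hftc x y hxy hIU,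
      star_sub]
    ring
  · exact ((hstar.tendsto cR).comp hcR).neg
  · exact ((hstar.tendsto cL).comp hcL).neg

/-- **`⟪W_max ζ, β_-⟫ − ⟪ζ, W_max β_-⟫ = −λ (conj c_{λ⁻} + conj c_{−λ⁺})`** for every `ζ ∈ dom W_max`:
Green's identity on `(−λ, λ)` against `θ(x) = x` (so `Wθ = 2x + qx`), the boundary terms
`p·g → 0` at `±λ` by §A. [cite: ConnesMoscovici2022, Lemma 1.5 and proof of Thm 1.6 (= arXiv:2112.05500 chunks p0005:L84–L110, p0006:L83–L85)] -/
theorem inner_sub_inner_betaMinus (hlam : 0 < lam) (hζ : ζ ∈ (prolateMax lam).domain)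
    (hae : ((ζ : ℝ → ℂ)) =ᵐ[volume] g) (hg : ContDiffOn ℝ 1 g {x | x ≠ lam ∧ x ≠ -lam})
    (hftc : ∀ x y, x ≤ y → Icc x y ⊆ {x | x ≠ lam ∧ x ≠ -lam} →
      pCoeff lam y * deriv g y - pCoeff lam x * deriv g x =
        ∫ t in x..y, (qCoeff lam t * g t - (prolateMax lam ⟨ζ, hζ⟩ : L2R) t))
    {cL cR : ℂ} (hcL : Tendsto (fun x ↦ pCoeff lam x * deriv g x) (𝓝[<] lam) (𝓝 cL))
    (hcR : Tendsto (fun x ↦ pCoeff lam x * deriv g x) (𝓝[>] (-lam)) (𝓝 cR)) :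
    ⟪(prolateMax lam ⟨ζ, hζ⟩ : L2R), betaMinus lam hlam⟫_ℂ -
      ⟪ζ, (prolateMax lam ⟨betaMinus lam hlam, (betaMinus_mem_prolateMax hlam).1⟩ : L2R)⟫_ℂ =
      -lam * (star cL + star cR) := by
  set η : L2R := prolateMax lam ⟨ζ, hζ⟩ with hηdef
  set η₂ : L2R := prolateMax lam ⟨betaMinus lam hlam, (betaMinus_mem_prolateMax hlam).1⟩ with hη₂def
  set g₂ : ℝ → ℂ := (Ioo (-lam) lam).indicator fun t : ℝ ↦ (t : ℂ) with hg₂def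
  have hae₂ : ((betaMinus lam hlam : L2R) : ℝ → ℂ) =ᵐ[volume] g₂ := by
    filter_upwards [betaMinus_coeFn hlam, ae_ne_two lam] with t ht hne
    rw [ht, hg₂def, indicator_Ioo_eq_Icc_of_ne' hne]
  have hη₂ := prolateMax_betaMinus_coeFn hlam
  rw [← integral_F_eq_inner_sub (η₁ := η) (η₂ := η₂) hae hae₂]
  set F : ℝ → ℂ := fun t ↦ star ((η : ℝ → ℂ) t) * g₂ t - star (g t) * (η₂ : ℝ → ℂ) t with hFdef
  have hFsupp : F =ᵐ[volume] (Ioo (-lam) lam).indicator F := by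
    filter_upwards [hη₂, ae_ne_two lam] with t ht hne
    by_cases htI : t ∈ Ioo (-lam) lam
    · rw [indicator_of_mem htI]
    · rw [indicator_of_notMem htI, hFdef]
      simp only
      rw [ht, ← indicator_Ioo_eq_Icc_of_ne' hne, hg₂def, indicator_of_notMem htI,
        indicator_of_notMem htI, mul_zero, mul_zero, sub_zero]
  rw [integral_eq_intervalIntegral_of_support hlam hFsupp]
  have hFi : Integrable F := integrable_F' (η₁ := η) (η₂ := η₂) hae hae₂
  have hstar : Continuous (star : ℂ → ℂ) := continuous_star
  -- the conjugated triple `(star g, q·star g − star η)` and Green against `θ(t) = t`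
  set U : Set ℝ := {x | x ≠ lam ∧ x ≠ -lam} with hU
  have hUo : IsOpen U := isOpen_U' lam
  have hgs : ContDiffOn ℝ 1 (fun t ↦ star (g t)) U :=
    (Complex.conjCLE.contDiff.comp_contDiffOn hg)
  have hdstar : ∀ s ∈ U, deriv (fun t ↦ star (g t)) s = star (deriv g s) := fun s hs ↦
    (((hg.differentiableOn one_ne_zero s hs).differentiableAt (hUo.mem_nhds hs)).hasDerivAt.star).deriv
  have hθ : ContDiff ℝ 2 (fun t : ℝ ↦ (t : ℂ)) := ofRealCLM.contDiff
  have hid : ∀ t : ℝ, deriv (fun s : ℝ ↦ (s : ℂ)) t = 1 := fun t ↦ by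
    simpa using ((hasDerivAt_id t).ofReal_comp).deriv
  have hWθ : ∀ t : ℝ, -deriv (fun s ↦ pCoeff lam s * deriv (fun s : ℝ ↦ (s : ℂ)) s) t +
      qCoeff lam t * (t : ℂ) = 2 * (t : ℂ) + qCoeff lam t * t := by
    intro t
    have e : (fun s ↦ pCoeff lam s * deriv (fun s : ℝ ↦ (s : ℂ)) s) = pCoeff lam := by
      funext s; rw [hid, mul_one]
    rw [e, (hasDerivAt_pCoeff_def lam t).deriv]; push_cast; ring
  have H := intervalIntegral_eq_sub_of_boundary_tendsto (by linarith : -lam < lam) hFi.intervalIntegrable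
    (B := fun s ↦ -((s : ℂ) * star (pCoeff lam s * deriv g s)) + star (pCoeff lam s * g s))
    (La := -((((-lam : ℝ)) : ℂ) * star cR) + 0) (Lb := -(((lam : ℝ) : ℂ) * star cL) + 0) ?_ ?_ ?_
  · rw [H]; push_cast; ring
  · intro x hx y hy hxy
    have hIU : Icc x y ⊆ U := Icc_subset_U_of_mem_Ioo hx hy
    -- FTC form for the conjugated triple on `[x, y]`
    have hFstar : ∀ s ∈ Icc x y, pCoeff lam s * deriv (fun t ↦ star (g t)) s -
        pCoeff lam x * deriv (fun t ↦ star (g t)) x =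
        ∫ t in x..s, (qCoeff lam t * star (g t) - star ((η : ℝ → ℂ) t)) := by
      intro s hs
      rw [hdstar s (hIU hs), hdstar x (hIU ⟨le_rfl, hxy⟩)]
      have h := hftc x s hs.1 ((Icc_subset_Icc_right hs.2).trans hIU)
      have h' := congrArg star h
      rw [star_sub, star_mul', star_mul', star_pCoeff', star_pCoeff', star_intervalIntegral' hs.1] at h'
      rw [h']
      refine intervalIntegral.integral_congr fun t _ ↦ ?_
      simp only [star_sub, star_mul', star_qCoeff']
    have hqc : Continuous (qCoeff lam) := continuous_qCoeff_def lam
    have hgc : ContinuousOn g (Icc x y) := (hg.continuousOn).mono hIU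
    have hfI : IntervalIntegrable (fun t ↦ qCoeff lam t * star (g t) - star ((η : ℝ → ℂ) t))
        volume x y := by
      refine (ContinuousOn.intervalIntegrable ?_).sub ?_
      · rw [uIcc_of_le hxy]
        exact hqc.continuousOn.mul (hstar.comp_continuousOn hgc)
      · have hη' : IntervalIntegrable (fun t ↦ ((η : ℝ → ℂ)) t) volume x y :=
          (intervalIntegrable_iff').2
            ((((Lp.memLp η).locallyIntegrable (by norm_num)).integrableOn_isCompact isCompact_uIcc))
        constructor
        · exact (Complex.conjCLE : ℂ →L[ℝ] ℂ).integrable_comp hη'.1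
        · exact (Complex.conjCLE : ℂ →L[ℝ] ℂ).integrable_comp hη'.2
    have hGreen := intervalIntegral_green_of_contDiffOn lam hxy hUo hIU hθ hgs hFstar hfI
    -- identify the Green integrand with `−F` on `[x, y]`
    have h1 : ∫ t in x..y, F t = -∫ t in x..y,
        ((-deriv (fun s ↦ pCoeff lam s * deriv (fun s : ℝ ↦ (s : ℂ)) s) t + qCoeff lam t * (t : ℂ)) *
          star (g t) - (t : ℂ) * (qCoeff lam t * star (g t) -
            (qCoeff lam t * star (g t) - star ((η : ℝ → ℂ) t)))) := by
      rw [← intervalIntegral.integral_neg]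
      refine intervalIntegral.integral_congr_ae ?_
      filter_upwards [hη₂] with t ht htI
      rw [uIoc_of_le hxy] at htI
      have htIoo : t ∈ Ioo (-lam) lam := ⟨hx.1.trans htI.1, htI.2.trans_lt hy.2⟩
      rw [hFdef, hWθ t]
      simp only
      rw [ht, hg₂def, indicator_of_mem htIoo, indicator_of_mem (Ioo_subset_Icc_self htIoo)]
      ring
    rw [h1, hGreen, hid, hid, hdstar y (hIU ⟨hxy, le_rfl⟩), hdstar x (hIU ⟨le_rfl, hxy⟩)]
    simp only [star_mul', star_pCoeff']
    ring
  · have h1 : Tendsto (fun s : ℝ ↦ -((s : ℂ) * star (pCoeff lam s * deriv g s)))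
        (𝓝[>] (-lam)) (𝓝 (-((((-lam : ℝ)) : ℂ) * star cR))) :=
      ((continuous_ofReal.tendsto (-lam)).mono_left nhdsWithin_le_nhds).mul
        ((hstar.tendsto cR).comp hcR) |>.neg
    have h2 : Tendsto (fun s : ℝ ↦ star (pCoeff lam s * g s)) (𝓝[>] (-lam)) (𝓝 0) := by
      have := (hstar.tendsto 0).comp (tendsto_pCoeff_mul_zero_nhdsGT_neg_lam hlam hg hcR)
      rwa [star_zero] at this
    exact h1.add h2
  · have h1 : Tendsto (fun s : ℝ ↦ -((s : ℂ) * star (pCoeff lam s * deriv g s)))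
        (𝓝[<] lam) (𝓝 (-(((lam : ℝ) : ℂ) * star cL))) :=
      ((continuous_ofReal.tendsto lam).mono_left nhdsWithin_le_nhds).mul
        ((hstar.tendsto cL).comp hcL) |>.neg
    have h2 : Tendsto (fun s : ℝ ↦ star (pCoeff lam s * g s)) (𝓝[<] lam) (𝓝 0) := by
      have := (hstar.tendsto 0).comp (tendsto_pCoeff_mul_zero_nhdsLT_lam hlam hg hcL)
      rwa [star_zero] at this
    exact h1.add h2

/-- **Orthogonality to `β_±` forces the inner limits to vanish.** [cite: ConnesMoscovici2022, proof of Thm 1.6, "𝓛_β = ⋂ Ker L_{β±} ∩ ⋂ Ker L_{β̂±}" (= arXiv:2112.05500 (2.16), chunk p0006:L48–L50)] -/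
theorem inner_limits_eq_zero (hlam : 0 < lam) (hζ : ζ ∈ (prolateMax lam).domain)
    (hae : ((ζ : ℝ → ℂ)) =ᵐ[volume] g) (hg : ContDiffOn ℝ 1 g {x | x ≠ lam ∧ x ≠ -lam})
    (hftc : ∀ x y, x ≤ y → Icc x y ⊆ {x | x ≠ lam ∧ x ≠ -lam} →
      pCoeff lam y * deriv g y - pCoeff lam x * deriv g x =
        ∫ t in x..y, (qCoeff lam t * g t - (prolateMax lam ⟨ζ, hζ⟩ : L2R) t))
    {cL cR : ℂ} (hcL : Tendsto (fun x ↦ pCoeff lam x * deriv g x) (𝓝[<] lam) (𝓝 cL))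
    (hcR : Tendsto (fun x ↦ pCoeff lam x * deriv g x) (𝓝[>] (-lam)) (𝓝 cR))
    (hP : ⟪(prolateMax lam ⟨ζ, hζ⟩ : L2R), betaPlus lam hlam⟫_ℂ =
      ⟪ζ, (prolateMax lam ⟨betaPlus lam hlam, (betaPlus_mem_prolateMax hlam).1⟩ : L2R)⟫_ℂ)
    (hM : ⟪(prolateMax lam ⟨ζ, hζ⟩ : L2R), betaMinus lam hlam⟫_ℂ =
      ⟪ζ, (prolateMax lam ⟨betaMinus lam hlam, (betaMinus_mem_prolateMax hlam).1⟩ : L2R)⟫_ℂ) :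
    cL = 0 ∧ cR = 0 := by
  have eP := inner_sub_inner_betaPlus hlam hζ hae hftc hcL hcR
  have eM := inner_sub_inner_betaMinus hlam hζ hae hg hftc hcL hcR
  rw [hP, sub_self] at eP
  rw [hM, sub_self] at eM
  have hl : ((lam : ℝ) : ℂ) ≠ 0 := by exact_mod_cast hlam.ne'
  have h1 : star cR = star cL := by linear_combination -eP
  have h2 : star cL + star cR = 0 := by
    have := mul_eq_zero.1 eM.symm
    rcases this with h | h
    · exact absurd (neg_eq_zero.1 h) hl
    · exact h
  have hL : star cL = 0 := by linear_combination (h2 - h1) / 2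
  have hR : star cR = 0 := by rw [h1, hL]
  exact ⟨by simpa using congrArg star hL, by simpa using congrArg star hR⟩

end LamSide

/-! ## §C. Lemma 1.2's "equality of the lateral limits": outer limit = inner limit at `±λ` -/

section Lateral

/-- `W θ = 0` where `θ` vanishes identically nearby. [cite: ConnesMoscovici2022, §1 eq. (1.1) (= arXiv:2112.05500 (2.1), chunk p0004:L5–L9)] -/
theorem prolateSchwartz_eq_zero_of_eventuallyEq {θ : 𝓢(ℝ, ℂ)} {t : ℝ}
    (h : (⇑θ : ℝ → ℂ) =ᶠ[𝓝 t] fun _ ↦ (0 : ℂ)) : prolateSchwartz lam θ t = 0 := by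
  rw [prolateSchwartz_apply']
  have hd : ∀ᶠ s in 𝓝 t, deriv (⇑θ) s = 0 := by
    filter_upwards [h.eventuallyEq_nhds] with s hs
    rw [hs.deriv_eq, deriv_const]
  have hpd : (fun s ↦ pCoeff lam s * deriv (⇑θ) s) =ᶠ[𝓝 t] fun _ ↦ (0 : ℂ) := by
    filter_upwards [hd] with s hs
    rw [hs, mul_zero]
  rw [hpd.deriv_eq, deriv_const, h.eq_of_nhds]
  simp

/-- `deriv θ = 0` where `θ` is locally constant. [folklore] -/
private theorem deriv_eq_zero_of_eventuallyEq_const {f : ℝ → ℂ} {t : ℝ} {c : ℂ}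
    (h : f =ᶠ[𝓝 t] fun _ ↦ c) : deriv f t = 0 := by
  rw [h.deriv_eq, deriv_const]

/-- A Mathlib bump (as a complex function) is `≡ 1` near every point of its open plateau. [folklore] -/
private theorem bump_eventuallyEq_one {a : ℝ} (φ : ContDiffBump a) {x : ℝ} (hx : dist x a < φ.rIn) :
    (fun t ↦ ((φ t : ℝ) : ℂ)) =ᶠ[𝓝 x] fun _ ↦ (1 : ℂ) := by
  have : ∀ᶠ t in 𝓝 x, dist t a < φ.rIn := Metric.isOpen_ball.mem_nhds hx
  filter_upwards [this] with t ht
  have h1 : φ t = 1 := φ.one_of_mem_closedBall (by rw [Metric.mem_closedBall]; exact ht.le)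
  simp [h1]

/-- A Mathlib bump vanishes near every point outside its closed support ball. [folklore] -/
private theorem bump_eventuallyEq_zero {a : ℝ} (φ : ContDiffBump a) {x : ℝ} (hx : φ.rOut < dist x a) :
    (fun t ↦ ((φ t : ℝ) : ℂ)) =ᶠ[𝓝 x] fun _ ↦ (0 : ℂ) := by
  have ho : IsOpen {t : ℝ | φ.rOut < dist t a} :=
    isOpen_lt continuous_const (continuous_id.dist continuous_const)
  filter_upwards [ho.mem_nhds hx] with t ht
  have h0 : φ t = 0 := φ.zero_of_le_dist (le_of_lt ht)
  simp [h0]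

/-- **`⟪W_max ζ, θ⟫ = ⟪ζ, W θ⟫` for `θ` in the Schwartz core** (`W_max = W_min^*`).
[cite: ConnesMoscovici2022, §1 ¶1, `W_max = (W_min)^*` (= arXiv:2112.05500 chunk p0004:L13–L22)] -/
theorem inner_prolateMax_schwartzToL2 {ζ : L2R} (hζ : ζ ∈ (prolateMax lam).domain) (θ : 𝓢(ℝ, ℂ)) :
    ⟪(prolateMax lam ⟨ζ, hζ⟩ : L2R), schwartzToL2 θ⟫_ℂ =
      ⟪ζ, schwartzToL2 (prolateSchwartz lam θ)⟫_ℂ := by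
  have hadj := LinearPMap.adjoint_isFormalAdjoint (T := prolateCore lam) dense_schwartzL2 ⟨ζ, hζ⟩
    ⟨schwartzToL2 θ, LinearMap.mem_range_self _ θ⟩
  rw [prolateCore_apply] at hadj
  exact hadj

variable {ζ : L2R} {g : ℝ → ℂ}

/-- **Equality of the lateral limits of `p g′` at a singular point** (Lemma 1.2: the distribution
`p∂_xξ` is a function CONTINUOUS near `±λ`; here for the regular representative of an arbitrary
`ζ ∈ dom W_max`, whose one-sided limits exist by `exists_regular_repr`): testing
`⟪W_max ζ, θ⟫ = ⟪ζ, Wθ⟫` against a bump `θ ≡ 1` near `a` and Green's formula on the two sides.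
[cite: ConnesMoscovici2022, Lemma 1.2 (ii) and its proof (= arXiv:2112.05500 Lemma 2.2, chunk p0004:L50–L90)] -/
theorem lateral_limits_eq (hlam : 0 < lam) (hζ : ζ ∈ (prolateMax lam).domain)
    (hae : ((ζ : ℝ → ℂ)) =ᵐ[volume] g) (hg : ContDiffOn ℝ 1 g {x | x ≠ lam ∧ x ≠ -lam})
    (hftc : ∀ x y, x ≤ y → Icc x y ⊆ {x | x ≠ lam ∧ x ≠ -lam} →
      pCoeff lam y * deriv g y - pCoeff lam x * deriv g x =
        ∫ t in x..y, (qCoeff lam t * g t - (prolateMax lam ⟨ζ, hζ⟩ : L2R) t))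
    {a : ℝ} (hU₁ : Ioo (a - lam) a ⊆ {x | x ≠ lam ∧ x ≠ -lam})
    (hU₂ : Ioo a (a + lam) ⊆ {x | x ≠ lam ∧ x ≠ -lam}) {c₁ c₂ : ℂ}
    (h₁ : Tendsto (fun x ↦ pCoeff lam x * deriv g x) (𝓝[<] a) (𝓝 c₁))
    (h₂ : Tendsto (fun x ↦ pCoeff lam x * deriv g x) (𝓝[>] a) (𝓝 c₂)) : c₁ = c₂ := by
  let φ : ContDiffBump a := ⟨lam / 4, lam / 2, by positivity, by linarith⟩
  have hφIn : φ.rIn = lam / 4 := rfl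
  have hφOut : φ.rOut = lam / 2 := rfl
  set κ : ℝ → ℂ := fun t ↦ ((φ t : ℝ) : ℂ) with hκdef
  have hκs : ContDiff ℝ (⊤ : ℕ∞) κ := ofRealCLM.contDiff.comp φ.contDiff
  have hκc : HasCompactSupport κ := φ.hasCompactSupport.comp_left ofReal_zero
  set θ : 𝓢(ℝ, ℂ) := hκc.toSchwartzMap hκs with hθdef
  set η : L2R := prolateMax lam ⟨ζ, hζ⟩ with hηdef
  set η₂ : L2R := schwartzToL2 (prolateSchwartz lam θ) with hη₂def
  set U : Set ℝ := {x | x ≠ lam ∧ x ≠ -lam} with hU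
  have hUo : IsOpen U := isOpen_U' lam
  have hstar : Continuous (star : ℂ → ℂ) := continuous_star
  -- smoothness of the bump and of `p κ′`
  have hκ : ContDiff ℝ 2 κ := ofRealCLM.contDiff.comp φ.contDiff
  have hκ1 : ContDiff ℝ 1 κ := hκ.of_le (by norm_num)
  have hκd1 : ContDiff ℝ 1 (deriv κ) := (contDiff_succ_iff_deriv.mp hκ).2.2
  have hpk : ContDiff ℝ 1 (fun s ↦ pCoeff lam s * deriv κ s) := (contDiff_pCoeff_def lam 1).mul hκd1
  have hθκ : (⇑θ : ℝ → ℂ) = κ := rfl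
  have hWκ : ∀ t, prolateSchwartz lam θ t =
      -deriv (fun s ↦ pCoeff lam s * deriv κ s) t + qCoeff lam t * κ t := by
    intro t; rw [prolateSchwartz_apply', hθκ]
  -- a.e. representatives
  have hae₂ : ((schwartzToL2 θ : L2R) : ℝ → ℂ) =ᵐ[volume] κ := by
    rw [← hθκ]; exact θ.coeFn_toLp 2 volume
  have hη₂ae : ((η₂ : L2R) : ℝ → ℂ) =ᵐ[volume] prolateSchwartz lam θ :=
    (prolateSchwartz lam θ).coeFn_toLp 2 volume
  -- `∫ F = ⟪W_max ζ, θ⟫ − ⟪ζ, Wθ⟫ = 0`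
  have hint0 : ∫ t, (star ((η : ℝ → ℂ) t) * κ t - star (g t) * (η₂ : ℝ → ℂ) t) = 0 := by
    rw [integral_F_eq_inner_sub (η₁ := η) (η₂ := η₂) hae hae₂, inner_prolateMax_schwartzToL2 hζ θ,
      sub_self]
  set F : ℝ → ℂ := fun t ↦ star ((η : ℝ → ℂ) t) * κ t - star (g t) * (η₂ : ℝ → ℂ) t with hFdef
  have hFi : Integrable F := integrable_F' (η₁ := η) (η₂ := η₂) hae hae₂
  -- where the bump (and `Wκ`) vanish / where the bump is `≡ 1`
  have hzero : ∀ s, lam / 2 < dist s a → κ s = 0 ∧ deriv κ s = 0 ∧ prolateSchwartz lam θ s = 0 := by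
    intro s hs
    have hev := bump_eventuallyEq_zero φ (by rw [hφOut]; exact hs)
    refine ⟨hev.eq_of_nhds, deriv_eq_zero_of_eventuallyEq_const hev, ?_⟩
    exact prolateSchwartz_eq_zero_of_eventuallyEq (by rw [hθκ]; exact hev)
  have hone : ∀ s, dist s a < lam / 4 → κ s = 1 ∧ deriv κ s = 0 := by
    intro s hs
    have hev := bump_eventuallyEq_one φ (by rw [hφIn]; exact hs)
    exact ⟨hev.eq_of_nhds, deriv_eq_zero_of_eventuallyEq_const hev⟩
  -- support of `F`
  have hFsupp : F =ᵐ[volume] (Ioo (a - lam) (a + lam)).indicator F := by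
    filter_upwards [hη₂ae] with t ht
    by_cases htI : t ∈ Ioo (a - lam) (a + lam)
    · rw [indicator_of_mem htI]
    · rw [indicator_of_notMem htI, hFdef]
      have hdist : lam / 2 < dist t a := by
        rw [Real.dist_eq]
        simp only [mem_Ioo, not_and_or, not_lt] at htI
        rcases htI with h | h
        · rw [abs_of_nonpos (by linarith)]; linarith
        · rw [abs_of_nonneg (by linarith)]; linarith
      obtain ⟨hk0, -, hW0⟩ := hzero t hdist
      simp only
      rw [ht, hk0, hW0, mul_zero, mul_zero, sub_zero]
  have hint : ∫ t, F t = ∫ t in (a - lam)..(a + lam), F t := by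
    rw [integral_congr_ae hFsupp, MeasureTheory.integral_indicator measurableSet_Ioo,
      intervalIntegral.integral_of_le (by linarith), integral_Ioc_eq_integral_Ioo]
  -- Green on compact pieces: the FTC form for the bump triple
  have hκU : ContDiffOn ℝ 1 κ U := hκ1.contDiffOn
  have hftcκ : ∀ x y, x ≤ y → Icc x y ⊆ U →
      pCoeff lam y * deriv κ y - pCoeff lam x * deriv κ x =
        ∫ t in x..y, (qCoeff lam t * κ t - (η₂ : ℝ → ℂ) t) := by
    intro x y hxy _
    have h1 : ∫ t in x..y, (qCoeff lam t * κ t - (η₂ : ℝ → ℂ) t) =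
        ∫ t in x..y, deriv (fun s ↦ pCoeff lam s * deriv κ s) t := by
      refine intervalIntegral.integral_congr_ae ?_
      filter_upwards [hη₂ae] with t ht _
      rw [ht, hWκ]; ring
    rw [h1]
    exact (integral_eq_sub_of_hasDerivAt
      (fun t _ ↦ ((hpk.differentiable one_ne_zero) t).hasDerivAt)
      ((hpk.continuous_deriv le_rfl).intervalIntegrable _ _)).symm
  set B : ℝ → ℂ := fun s ↦ star (g s) * (pCoeff lam s * deriv κ s) -
    star (pCoeff lam s * deriv g s) * κ s with hBdef
  have hId : ∀ x y, x ≤ y → Icc x y ⊆ U → ∫ t in x..y, F t = B y - B x := by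
    intro x y hxy hI
    exact intervalIntegral_lagrange_pair (η₁ := η) (η₂ := η₂) hg hftc hκU hftcκ hxy hI
  -- boundary behaviour of `B`
  have hBfar : ∀ s, lam / 2 < dist s a → B s = 0 := by
    intro s hs
    obtain ⟨hk0, hkd0, -⟩ := hzero s hs
    simp only [hBdef, hk0, hkd0, mul_zero, sub_zero]
  have hBnear : ∀ s, dist s a < lam / 4 → B s = -star (pCoeff lam s * deriv g s) := by
    intro s hs
    obtain ⟨hk1, hkd0⟩ := hone s hs
    simp only [hBdef, hk1, hkd0, mul_zero, mul_one, zero_sub]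
  -- piece 1: `(a − λ, a)`
  have hP1 : ∫ t in (a - lam)..a, F t = -star c₁ - 0 := by
    refine intervalIntegral_eq_sub_of_boundary_tendsto (by linarith) (hFi.intervalIntegrable)
      (B := B) (fun x hx y hy hxy ↦ hId x y hxy fun t ht ↦ hU₁ ⟨hx.1.trans_le ht.1,
        ht.2.trans_lt hy.2⟩) ?_ ?_
    · refine tendsto_const_nhds.congr' ?_
      filter_upwards [Ioo_mem_nhdsGT (by linarith : a - lam < a - lam / 2)] with s hs
      refine (hBfar s ?_).symm
      rw [Real.dist_eq, abs_of_nonpos (by linarith [hs.2])]; linarith [hs.2]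
    · have hT : Tendsto (fun s ↦ -star (pCoeff lam s * deriv g s)) (𝓝[<] a) (𝓝 (-star c₁)) :=
        ((hstar.tendsto c₁).comp h₁).neg
      refine hT.congr' ?_
      filter_upwards [Ioo_mem_nhdsLT (by linarith : a - lam / 4 < a)] with s hs
      refine (hBnear s ?_).symm
      rw [Real.dist_eq, abs_of_nonpos (by linarith [hs.2])]; linarith [hs.1]
  -- piece 2: `(a, a + λ)`
  have hP2 : ∫ t in a..(a + lam), F t = 0 - -star c₂ := by
    refine intervalIntegral_eq_sub_of_boundary_tendsto (by linarith) (hFi.intervalIntegrable)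
      (B := B) (fun x hx y hy hxy ↦ hId x y hxy fun t ht ↦ hU₂ ⟨hx.1.trans_le ht.1,
        ht.2.trans_lt hy.2⟩) ?_ ?_
    · have hT : Tendsto (fun s ↦ -star (pCoeff lam s * deriv g s)) (𝓝[>] a) (𝓝 (-star c₂)) :=
        ((hstar.tendsto c₂).comp h₂).neg
      refine hT.congr' ?_
      filter_upwards [Ioo_mem_nhdsGT (by linarith : a < a + lam / 4)] with s hs
      refine (hBnear s ?_).symm
      rw [Real.dist_eq, abs_of_nonneg (by linarith [hs.1])]; linarith [hs.2]
    · refine tendsto_const_nhds.congr' ?_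
      filter_upwards [Ioo_mem_nhdsLT (by linarith : a + lam / 2 < a + lam)] with s hs
      refine (hBfar s ?_).symm
      rw [Real.dist_eq, abs_of_nonneg (by linarith [hs.1])]; linarith [hs.1]
  have hsplit : ∫ t in (a - lam)..(a + lam), F t =
      (∫ t in (a - lam)..a, F t) + ∫ t in a..(a + lam), F t :=
    (intervalIntegral.integral_add_adjacent_intervals hFi.intervalIntegrable
      hFi.intervalIntegrable).symm
  have h0 : (0 : ℂ) = -star c₁ + star c₂ := by
    rw [← hint0]
    change ∫ t, F t = _
    rw [hint, hsplit, hP1, hP2]; ring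
  have : star c₁ = star c₂ := by linear_combination h0
  simpa using congrArg star this

/-- **At `λ`: outer limit = inner limit.** [cite: ConnesMoscovici2022, Lemma 1.2 (ii) (= arXiv:2112.05500 Lemma 2.2, chunk p0004:L50–L52)] -/
theorem lateral_limits_eq_lam (hlam : 0 < lam) (hζ : ζ ∈ (prolateMax lam).domain)
    (hae : ((ζ : ℝ → ℂ)) =ᵐ[volume] g) (hg : ContDiffOn ℝ 1 g {x | x ≠ lam ∧ x ≠ -lam})
    (hftc : ∀ x y, x ≤ y → Icc x y ⊆ {x | x ≠ lam ∧ x ≠ -lam} →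
      pCoeff lam y * deriv g y - pCoeff lam x * deriv g x =
        ∫ t in x..y, (qCoeff lam t * g t - (prolateMax lam ⟨ζ, hζ⟩ : L2R) t))
    {c₁ c₂ : ℂ} (h₁ : Tendsto (fun x ↦ pCoeff lam x * deriv g x) (𝓝[<] lam) (𝓝 c₁))
    (h₂ : Tendsto (fun x ↦ pCoeff lam x * deriv g x) (𝓝[>] lam) (𝓝 c₂)) : c₁ = c₂ :=
  lateral_limits_eq hlam hζ hae hg hftc (a := lam)
    (fun x hx ↦ ⟨hx.2.ne, by intro h; simp only [mem_Ioo] at hx; linarith [hx.1]⟩)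
    (fun x hx ↦ ⟨hx.1.ne', by intro h; simp only [mem_Ioo] at hx; linarith [hx.1]⟩) h₁ h₂

/-- **At `−λ`: outer limit = inner limit.** [cite: ConnesMoscovici2022, Lemma 1.2 (ii) (= arXiv:2112.05500 Lemma 2.2, chunk p0004:L50–L52)] -/
theorem lateral_limits_eq_neg_lam (hlam : 0 < lam) (hζ : ζ ∈ (prolateMax lam).domain)
    (hae : ((ζ : ℝ → ℂ)) =ᵐ[volume] g) (hg : ContDiffOn ℝ 1 g {x | x ≠ lam ∧ x ≠ -lam})
    (hftc : ∀ x y, x ≤ y → Icc x y ⊆ {x | x ≠ lam ∧ x ≠ -lam} →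
      pCoeff lam y * deriv g y - pCoeff lam x * deriv g x =
        ∫ t in x..y, (qCoeff lam t * g t - (prolateMax lam ⟨ζ, hζ⟩ : L2R) t))
    {c₁ c₂ : ℂ} (h₁ : Tendsto (fun x ↦ pCoeff lam x * deriv g x) (𝓝[<] (-lam)) (𝓝 c₁))
    (h₂ : Tendsto (fun x ↦ pCoeff lam x * deriv g x) (𝓝[>] (-lam)) (𝓝 c₂)) : c₁ = c₂ :=
  lateral_limits_eq hlam hζ hae hg hftc (a := -lam)
    (fun x hx ↦ ⟨by intro h; simp only [mem_Ioo] at hx; linarith [hx.2], hx.2.ne⟩)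
    (fun x hx ↦ ⟨by intro h; simp only [mem_Ioo] at hx; linarith [hx.2], hx.1.ne'⟩) h₁ h₂

end Lateral

/-! ## §D. The `∞`-side toolkit: limits of the Lagrange boundary form from the `+∞` asymptotics -/

section InfSide

/-- `(→ 0) · (bounded) → 0`. [folklore] -/
private theorem tendsto_zero_mul_of_norm_le' {l : Filter ℝ} {e b : ℝ → ℂ} {C : ℝ}
    (he : Tendsto e l (𝓝 0)) (hb : ∀ᶠ x in l, ‖b x‖ ≤ C) : Tendsto (fun x ↦ e x * b x) l (𝓝 0) := by
  refine squeeze_zero_norm' ?_ (by simpa using he.norm.mul_const C)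
  filter_upwards [hb] with x hx
  rw [norm_mul]
  exact mul_le_mul_of_nonneg_left hx (norm_nonneg _)

/-- `(bounded) · (→ 0) → 0`. [folklore] -/
private theorem tendsto_mul_zero_of_norm_le' {l : Filter ℝ} {b e : ℝ → ℂ} {C : ℝ}
    (hb : ∀ᶠ x in l, ‖b x‖ ≤ C) (he : Tendsto e l (𝓝 0)) : Tendsto (fun x ↦ b x * e x) l (𝓝 0) :=
  (tendsto_zero_mul_of_norm_le' he hb).congr fun _ ↦ mul_comm _ _

/-- `star r = r` for real `r`. [folklore] -/
private theorem star_ofReal'' (r : ℝ) : star ((r : ℂ)) = (r : ℂ) := Complex.conj_ofReal r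

/-- `|sin| ≤ 1`. [folklore] -/
private theorem norm_real_sin_le' (y : ℝ) : ‖(Real.sin y : ℂ)‖ ≤ 1 := by
  rw [Complex.norm_real, Real.norm_eq_abs]; exact Real.abs_sin_le_one y

/-- `|cos| ≤ 1`. [folklore] -/
private theorem norm_real_cos_le' (y : ℝ) : ‖(Real.cos y : ℂ)‖ ≤ 1 := by
  rw [Complex.norm_real, Real.norm_eq_abs]; exact Real.abs_cos_le_one y

/-- `‖A sin + B cos‖ ≤ ‖A‖ + ‖B‖`. [folklore] -/
private theorem norm_sin_cos_comb_le' (A B : ℂ) (y : ℝ) :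
    ‖A * (Real.sin y : ℂ) + B * (Real.cos y : ℂ)‖ ≤ ‖A‖ + ‖B‖ := by
  refine (norm_add_le _ _).trans (add_le_add ?_ ?_)
  · rw [norm_mul]; exact mul_le_of_le_one_right (norm_nonneg _) (norm_real_sin_le' y)
  · rw [norm_mul]; exact mul_le_of_le_one_right (norm_nonneg _) (norm_real_cos_le' y)

/-- `‖w(A cos − B sin)‖ ≤ ‖w‖(‖A‖ + ‖B‖)`. [folklore] -/
private theorem norm_cos_sin_comb_le' (w A B : ℂ) (y : ℝ) :
    ‖w * (A * (Real.cos y : ℂ) - B * (Real.sin y : ℂ))‖ ≤ ‖w‖ * (‖A‖ + ‖B‖) := by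
  rw [norm_mul]
  refine mul_le_mul_of_nonneg_left ((norm_sub_le _ _).trans (add_le_add ?_ ?_)) (norm_nonneg _)
  · rw [norm_mul]; exact mul_le_of_le_one_right (norm_nonneg _) (norm_real_cos_le' y)
  · rw [norm_mul]; exact mul_le_of_le_one_right (norm_nonneg _) (norm_real_sin_le' y)

/-- `sin² + cos² = 1` in `ℂ`. [folklore] -/
private theorem sin_sq_add_cos_sq'' (y : ℝ) :
    (Real.sin y : ℂ) ^ 2 + (Real.cos y : ℂ) ^ 2 = 1 := by
  exact_mod_cast Real.sin_sq_add_cos_sq y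

/-- (1.20)'s expression rearranged. [folklore] -/
private theorem bcInfEven_expand' (lam : ℝ) (h : ℝ → ℂ) (x : ℝ) :
    bcInfEven lam h x = (Real.sin (2 * π * lam * x) : ℂ) * (h x + x * deriv h x) -
      ((2 * π * lam : ℝ) : ℂ) * ((Real.cos (2 * π * lam * x) : ℂ) * ((x : ℂ) * h x)) := by
  simp only [bcInfEven]
  push_cast
  ring

/-- (1.21)'s expression rearranged. [folklore] -/
private theorem bcInfOdd_expand' (lam : ℝ) (h : ℝ → ℂ) (x : ℝ) :
    bcInfOdd lam h x = (Real.cos (2 * π * lam * x) : ℂ) * (h x + x * deriv h x) +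
      ((2 * π * lam : ℝ) : ℂ) * ((Real.sin (2 * π * lam * x) : ℂ) * ((x : ℂ) * h x)) := by
  simp only [bcInfOdd]
  push_cast
  ring

/-- Abstract pairing limit: if `Uᵢ − mᵢ → 0`, `Vᵢ − nᵢ → 0` with bounded models whose pairing
`conj m₁ · n₂ − conj n₁ · m₂` is the constant `L`, then `conj U₁ · V₂ − conj V₁ · U₂ → L` (the abstract
form of "the known form of the solutions around `±∞`" ⇒ Lagrange bracket at `∞`). [cite: ConnesMoscovici2022, Lemma 1.5 proof, (1.18) (= arXiv:2112.05500 chunks p0005:L94–L110, p0006:L4–L30)] -/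
theorem tendsto_pairing_of_model {l : Filter ℝ} {U₁ U₂ V₁ V₂ m₁ m₂ n₁ n₂ : ℝ → ℂ}
    {C₁ C₂ C₃ C₄ : ℝ} {L : ℂ} (hm₁ : ∀ᶠ x in l, ‖m₁ x‖ ≤ C₁) (hm₂ : ∀ᶠ x in l, ‖m₂ x‖ ≤ C₂)
    (hn₁ : ∀ᶠ x in l, ‖n₁ x‖ ≤ C₃) (hn₂ : ∀ᶠ x in l, ‖n₂ x‖ ≤ C₄)
    (hid : ∀ x, star (m₁ x) * n₂ x - star (n₁ x) * m₂ x = L)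
    (hU₁ : Tendsto (fun x ↦ U₁ x - m₁ x) l (𝓝 0)) (hU₂ : Tendsto (fun x ↦ U₂ x - m₂ x) l (𝓝 0))
    (hV₁ : Tendsto (fun x ↦ V₁ x - n₁ x) l (𝓝 0)) (hV₂ : Tendsto (fun x ↦ V₂ x - n₂ x) l (𝓝 0)) :
    Tendsto (fun x ↦ star (U₁ x) * V₂ x - star (V₁ x) * U₂ x) l (𝓝 L) := by
  have key : ∀ x, star (U₁ x) * V₂ x - star (V₁ x) * U₂ x - L =
      star (U₁ x - m₁ x) * (V₂ x - n₂ x) + star (U₁ x - m₁ x) * n₂ x +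
        star (m₁ x) * (V₂ x - n₂ x) - star (V₁ x - n₁ x) * (U₂ x - m₂ x) -
        star (V₁ x - n₁ x) * m₂ x - star (n₁ x) * (U₂ x - m₂ x) := by
    intro x
    rw [← hid x]
    simp only [star_sub]
    ring
  have hsU₁ : Tendsto (fun x ↦ star (U₁ x - m₁ x)) l (𝓝 0) := by simpa using hU₁.star
  have hsV₁ : Tendsto (fun x ↦ star (V₁ x - n₁ x)) l (𝓝 0) := by simpa using hV₁.star
  have hsm₁ : ∀ᶠ x in l, ‖star (m₁ x)‖ ≤ C₁ := by
    filter_upwards [hm₁] with x hx; rwa [norm_star]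
  have hsn₁ : ∀ᶠ x in l, ‖star (n₁ x)‖ ≤ C₃ := by
    filter_upwards [hn₁] with x hx; rwa [norm_star]
  have t1 : Tendsto (fun x ↦ star (U₁ x - m₁ x) * (V₂ x - n₂ x)) l (𝓝 0) := by
    simpa using hsU₁.mul hV₂
  have t2 : Tendsto (fun x ↦ star (U₁ x - m₁ x) * n₂ x) l (𝓝 0) :=
    tendsto_zero_mul_of_norm_le' hsU₁ hn₂
  have t3 : Tendsto (fun x ↦ star (m₁ x) * (V₂ x - n₂ x)) l (𝓝 0) :=
    tendsto_mul_zero_of_norm_le' hsm₁ hV₂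
  have t4 : Tendsto (fun x ↦ star (V₁ x - n₁ x) * (U₂ x - m₂ x)) l (𝓝 0) := by
    simpa using hsV₁.mul hU₂
  have t5 : Tendsto (fun x ↦ star (V₁ x - n₁ x) * m₂ x) l (𝓝 0) :=
    tendsto_zero_mul_of_norm_le' hsV₁ hm₂
  have t6 : Tendsto (fun x ↦ star (n₁ x) * (U₂ x - m₂ x)) l (𝓝 0) :=
    tendsto_mul_zero_of_norm_le' hsn₁ hU₂
  have h := ((((t1.add t2).add t3).sub t4).sub t5).sub t6
  simp only [add_zero, sub_zero] at h
  have h' : Tendsto (fun x ↦ star (U₁ x) * V₂ x - star (V₁ x) * U₂ x - L) l (𝓝 0) :=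
    h.congr fun x ↦ (key x).symm
  have := h'.add_const L
  simpa using this

/-- **Limit of the Lagrange boundary form from the `+∞` asymptotics.**  If, for `i = 1, 2`,
`x hᵢ − (Aᵢ sin ωx + Bᵢ cos ωx) → 0` and `(hᵢ + x hᵢ′) − ω(Aᵢ cos ωx − Bᵢ sin ωx) → 0` (`ω = 2πλ`, the
known form of solutions near `±∞`, Lemma 1.5 / (1.18)), then
`2p(R)·(conj h₁ h₂′ − conj h₁′ h₂)(R) → −2ω (conj B₁·A₂ − conj A₁·B₂)`: the symplectic pairing of
the asymptotic coefficients. [cite: ConnesMoscovici2022, Lemma 1.5 proof, (1.18) (= arXiv:2112.05500 chunks p0005:L94–L110, p0006:L4–L30)] -/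
theorem tendsto_boundaryPairing_of_model (lam : ℝ) {h₁ h₂ : ℝ → ℂ} {A₁ B₁ A₂ B₂ : ℂ}
    (hU₁ : Tendsto (fun x : ℝ ↦ (x : ℂ) * h₁ x -
      (A₁ * (Real.sin (2 * π * lam * x) : ℂ) + B₁ * (Real.cos (2 * π * lam * x) : ℂ))) atTop (𝓝 0))
    (hV₁ : Tendsto (fun x : ℝ ↦ (h₁ x + x * deriv h₁ x) - ((2 * π * lam : ℝ) : ℂ) *
      (A₁ * (Real.cos (2 * π * lam * x) : ℂ) - B₁ * (Real.sin (2 * π * lam * x) : ℂ))) atTop (𝓝 0))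
    (hU₂ : Tendsto (fun x : ℝ ↦ (x : ℂ) * h₂ x -
      (A₂ * (Real.sin (2 * π * lam * x) : ℂ) + B₂ * (Real.cos (2 * π * lam * x) : ℂ))) atTop (𝓝 0))
    (hV₂ : Tendsto (fun x : ℝ ↦ (h₂ x + x * deriv h₂ x) - ((2 * π * lam : ℝ) : ℂ) *
      (A₂ * (Real.cos (2 * π * lam * x) : ℂ) - B₂ * (Real.sin (2 * π * lam * x) : ℂ))) atTop (𝓝 0)) :
    Tendsto (fun R : ℝ ↦ 2 * pCoeff lam R *
        (star (h₁ R) * deriv h₂ R - star (deriv h₁ R) * h₂ R)) atTop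
      (𝓝 (-2 * ((2 * π * lam : ℝ) : ℂ) * (star B₁ * A₂ - star A₁ * B₂))) := by
  set ω : ℂ := ((2 * π * lam : ℝ) : ℂ) with hω
  have hωstar : star ω = ω := star_ofReal'' _
  -- the pairing of `U = x h`, `V = h + x h′` tends to `ω (conj B₁ A₂ − conj A₁ B₂)`
  have hP := tendsto_pairing_of_model (l := atTop)
    (U₁ := fun x : ℝ ↦ (x : ℂ) * h₁ x) (U₂ := fun x : ℝ ↦ (x : ℂ) * h₂ x)
    (V₁ := fun x : ℝ ↦ h₁ x + x * deriv h₁ x) (V₂ := fun x : ℝ ↦ h₂ x + x * deriv h₂ x)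
    (m₁ := fun x ↦ A₁ * (Real.sin (2 * π * lam * x) : ℂ) + B₁ * (Real.cos (2 * π * lam * x) : ℂ))
    (m₂ := fun x ↦ A₂ * (Real.sin (2 * π * lam * x) : ℂ) + B₂ * (Real.cos (2 * π * lam * x) : ℂ))
    (n₁ := fun x ↦ ω * (A₁ * (Real.cos (2 * π * lam * x) : ℂ) - B₁ * (Real.sin (2 * π * lam * x) : ℂ)))
    (n₂ := fun x ↦ ω * (A₂ * (Real.cos (2 * π * lam * x) : ℂ) - B₂ * (Real.sin (2 * π * lam * x) : ℂ)))
    (L := ω * (star B₁ * A₂ - star A₁ * B₂))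
    (Eventually.of_forall fun x ↦ norm_sin_cos_comb_le' A₁ B₁ _)
    (Eventually.of_forall fun x ↦ norm_sin_cos_comb_le' A₂ B₂ _)
    (Eventually.of_forall fun x ↦ norm_cos_sin_comb_le' _ A₁ B₁ _)
    (Eventually.of_forall fun x ↦ norm_cos_sin_comb_le' _ A₂ B₂ _)
    (fun x ↦ by
      simp only [star_add, star_sub, star_mul', star_ofReal'', hωstar]
      linear_combination (ω * (star B₁ * A₂ - star A₁ * B₂)) * sin_sq_add_cos_sq'' (2 * π * lam * x))
    hU₁ hU₂ hV₁ hV₂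
  -- `2p/R² → −2`
  have hq : Tendsto (fun R : ℝ ↦ ((2 * (lam ^ 2 - R ^ 2) / R ^ 2 : ℝ) : ℂ)) atTop (𝓝 ((-2 : ℝ) : ℂ)) := by
    refine (continuous_ofReal.tendsto _).comp ?_
    have h1 : Tendsto (fun R : ℝ ↦ 2 * lam ^ 2 * (R ^ 2)⁻¹ - 2) atTop (𝓝 (2 * lam ^ 2 * 0 - 2)) :=
      ((tendsto_inv_atTop_zero.comp (tendsto_pow_atTop two_ne_zero)).const_mul _).sub_const 2
    rw [mul_zero, zero_sub] at h1
    refine h1.congr' ?_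
    filter_upwards [eventually_gt_atTop 0] with R hR
    have : R ^ 2 ≠ 0 := by positivity
    field_simp
  have hprod := hq.mul hP
  have e : ((-2 : ℝ) : ℂ) * (ω * (star B₁ * A₂ - star A₁ * B₂)) =
      -2 * ω * (star B₁ * A₂ - star A₁ * B₂) := by push_cast; ring
  rw [e] at hprod
  refine hprod.congr' ?_
  filter_upwards [eventually_gt_atTop 0] with R hR
  have hR0 : (R : ℂ) ≠ 0 := by exact_mod_cast hR.ne'
  simp only [pCoeff, star_mul', star_add, star_ofReal'']
  push_cast
  field_simp
  ring

/-- **(1.20) from the asymptotics**: `bcInfEven λ h → −ω B`. [cite: ConnesMoscovici2022, §1 (1.18), (1.20) (= arXiv:2112.05500 (2.18), (2.20), chunk p0006:L18–L30, L64–L66)] -/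
theorem tendsto_bcInfEven_of_model (lam : ℝ) {h : ℝ → ℂ} {A B : ℂ}
    (hU : Tendsto (fun x : ℝ ↦ (x : ℂ) * h x -
      (A * (Real.sin (2 * π * lam * x) : ℂ) + B * (Real.cos (2 * π * lam * x) : ℂ))) atTop (𝓝 0))
    (hV : Tendsto (fun x : ℝ ↦ (h x + x * deriv h x) - ((2 * π * lam : ℝ) : ℂ) *
      (A * (Real.cos (2 * π * lam * x) : ℂ) - B * (Real.sin (2 * π * lam * x) : ℂ))) atTop (𝓝 0)) :
    Tendsto (bcInfEven lam h) atTop (𝓝 (-(((2 * π * lam : ℝ) : ℂ) * B))) := by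
  have key : ∀ x : ℝ, bcInfEven lam h x + ((2 * π * lam : ℝ) : ℂ) * B =
      (Real.sin (2 * π * lam * x) : ℂ) * ((h x + x * deriv h x) - ((2 * π * lam : ℝ) : ℂ) *
        (A * (Real.cos (2 * π * lam * x) : ℂ) - B * (Real.sin (2 * π * lam * x) : ℂ))) -
      ((2 * π * lam : ℝ) : ℂ) * ((Real.cos (2 * π * lam * x) : ℂ) * ((x : ℂ) * h x -
        (A * (Real.sin (2 * π * lam * x) : ℂ) + B * (Real.cos (2 * π * lam * x) : ℂ)))) := by
    intro x
    rw [bcInfEven_expand']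
    linear_combination (-((2 * π * lam : ℝ) : ℂ) * B) * sin_sq_add_cos_sq'' (2 * π * lam * x)
  have t1 := tendsto_mul_zero_of_norm_le' (b := fun x : ℝ ↦ (Real.sin (2 * π * lam * x) : ℂ))
    (Eventually.of_forall fun x ↦ norm_real_sin_le' (2 * π * lam * x)) hV
  have t2 := (tendsto_mul_zero_of_norm_le' (b := fun x : ℝ ↦ (Real.cos (2 * π * lam * x) : ℂ))
    (Eventually.of_forall fun x ↦ norm_real_cos_le' (2 * π * lam * x)) hU).const_mul
    ((2 * π * lam : ℝ) : ℂ)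
  have h1 : Tendsto (fun x ↦ bcInfEven lam h x + ((2 * π * lam : ℝ) : ℂ) * B) atTop (𝓝 0) := by
    have h := t1.sub t2
    simp only [mul_zero, sub_zero] at h
    exact h.congr fun x ↦ (key x).symm
  have := h1.sub_const (((2 * π * lam : ℝ) : ℂ) * B)
  simp only [zero_sub] at this
  refine this.congr fun x ↦ ?_
  ring

/-- **(1.21) from the asymptotics**: `bcInfOdd λ h → ω A`. [cite: ConnesMoscovici2022, §1 (1.18), (1.21) (= arXiv:2112.05500 (2.18), (2.21), chunk p0006:L15–L30, L67–L69)] -/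
theorem tendsto_bcInfOdd_of_model (lam : ℝ) {h : ℝ → ℂ} {A B : ℂ}
    (hU : Tendsto (fun x : ℝ ↦ (x : ℂ) * h x -
      (A * (Real.sin (2 * π * lam * x) : ℂ) + B * (Real.cos (2 * π * lam * x) : ℂ))) atTop (𝓝 0))
    (hV : Tendsto (fun x : ℝ ↦ (h x + x * deriv h x) - ((2 * π * lam : ℝ) : ℂ) *
      (A * (Real.cos (2 * π * lam * x) : ℂ) - B * (Real.sin (2 * π * lam * x) : ℂ))) atTop (𝓝 0)) :
    Tendsto (bcInfOdd lam h) atTop (𝓝 (((2 * π * lam : ℝ) : ℂ) * A)) := by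
  have key : ∀ x : ℝ, bcInfOdd lam h x - ((2 * π * lam : ℝ) : ℂ) * A =
      (Real.cos (2 * π * lam * x) : ℂ) * ((h x + x * deriv h x) - ((2 * π * lam : ℝ) : ℂ) *
        (A * (Real.cos (2 * π * lam * x) : ℂ) - B * (Real.sin (2 * π * lam * x) : ℂ))) +
      ((2 * π * lam : ℝ) : ℂ) * ((Real.sin (2 * π * lam * x) : ℂ) * ((x : ℂ) * h x -
        (A * (Real.sin (2 * π * lam * x) : ℂ) + B * (Real.cos (2 * π * lam * x) : ℂ)))) := by
    intro x
    rw [bcInfOdd_expand']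
    linear_combination (((2 * π * lam : ℝ) : ℂ) * A) * sin_sq_add_cos_sq'' (2 * π * lam * x)
  have t1 := tendsto_mul_zero_of_norm_le' (b := fun x : ℝ ↦ (Real.cos (2 * π * lam * x) : ℂ))
    (Eventually.of_forall fun x ↦ norm_real_cos_le' (2 * π * lam * x)) hV
  have t2 := (tendsto_mul_zero_of_norm_le' (b := fun x : ℝ ↦ (Real.sin (2 * π * lam * x) : ℂ))
    (Eventually.of_forall fun x ↦ norm_real_sin_le' (2 * π * lam * x)) hU).const_mul
    ((2 * π * lam : ℝ) : ℂ)
  have h1 : Tendsto (fun x ↦ bcInfOdd lam h x - ((2 * π * lam : ℝ) : ℂ) * A) atTop (𝓝 0) := by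
    have h := t1.add t2
    simp only [mul_zero, add_zero] at h
    exact h.congr fun x ↦ (key x).symm
  have := h1.add_const (((2 * π * lam : ℝ) : ℂ) * A)
  simp only [zero_add] at this
  refine this.congr fun x ↦ ?_
  ring

/-- **The model data of `φ_+`**: `x φ_+(x) = sin(ωx)/π` and `φ_+ + x φ_+′ = (ω/π) cos(ωx)` off `0`
(so `A = 1/π`, `B = 0`, exactly). [cite: ConnesMoscovici2022, Lemma 1.4 (ii) / Lemma 1.5 proof (= arXiv:2112.05500 chunk p0005:L75–L76, L94–L104)] -/
theorem phiPlus_model (hlam : 0 < lam) {x : ℝ} (hx : x ≠ 0) :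
    (x : ℂ) * phiPlus lam x = ((1 / π : ℝ) : ℂ) * (Real.sin (2 * π * lam * x) : ℂ) ∧
    phiPlus lam x + x * deriv (phiPlus lam) x =
      ((2 * π * lam : ℝ) : ℂ) * (((1 / π : ℝ) : ℂ) * (Real.cos (2 * π * lam * x) : ℂ)) := by
  have hπ : (π : ℂ) ≠ 0 := by exact_mod_cast Real.pi_ne_zero
  have hx' : (x : ℂ) ≠ 0 := by exact_mod_cast hx
  rw [phiPlus_of_ne_zero hlam hx, deriv_phiPlus_of_ne_zero hlam hx]
  push_cast
  constructor
  · field_simp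
  · field_simp
    ring

/-- The model asymptotics of `φ_+` in the `Tendsto` form (`A = 1/π`, `B = 0`). [cite: ConnesMoscovici2022, Lemma 1.5 proof (= arXiv:2112.05500 chunk p0005:L94–L104)] -/
theorem phiPlus_model_tendsto (hlam : 0 < lam) :
    Tendsto (fun x : ℝ ↦ (x : ℂ) * phiPlus lam x -
      (((1 / π : ℝ) : ℂ) * (Real.sin (2 * π * lam * x) : ℂ) + 0 * (Real.cos (2 * π * lam * x) : ℂ)))
      atTop (𝓝 0) ∧
    Tendsto (fun x : ℝ ↦ (phiPlus lam x + x * deriv (phiPlus lam) x) - ((2 * π * lam : ℝ) : ℂ) *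
      (((1 / π : ℝ) : ℂ) * (Real.cos (2 * π * lam * x) : ℂ) - 0 * (Real.sin (2 * π * lam * x) : ℂ)))
      atTop (𝓝 0) := by
  constructor
  · refine tendsto_const_nhds.congr' ?_
    filter_upwards [eventually_gt_atTop 0] with x hx
    rw [(phiPlus_model hlam hx.ne').1]; ring
  · refine tendsto_const_nhds.congr' ?_
    filter_upwards [eventually_gt_atTop 0] with x hx
    rw [(phiPlus_model hlam hx.ne').2]; ring

end InfSide

section PhiMinusModel

/-- **`φ_- + x φ_-′` off `0`**: `(x φ_-)′ = (i/2π²)(−ω² sin ωx − (ωx cos ωx − sin ωx)/x²)`.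
[cite: ConnesMoscovici2022, Lemma 1.5 proof, `β̂_- = (i/2π)∂β̂_+` (= arXiv:2112.05500 chunk p0005:L96–L104)] -/
theorem phiMinus_add_mul_deriv (hlam : 0 < lam) {x : ℝ} (hx : x ≠ 0) :
    phiMinus lam x + x * deriv (phiMinus lam) x =
      I * (((-(2 * π * lam) ^ 2 * Real.sin (2 * π * lam * x) -
        (2 * π * lam * x * Real.cos (2 * π * lam * x) - Real.sin (2 * π * lam * x)) / x ^ 2) /
          (2 * π ^ 2) : ℝ) : ℂ) := by
  set ω : ℝ := 2 * π * lam with hω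
  set N : ℝ → ℝ := fun t ↦ ω * t * Real.cos (ω * t) - Real.sin (ω * t) with hNdef
  set D : ℝ → ℝ := fun t ↦ 2 * π ^ 2 * t ^ 2 with hDdef
  have hev : phiMinus lam =ᶠ[𝓝 x] fun t : ℝ ↦ I * (((N / D) t : ℝ) : ℂ) := by
    filter_upwards [isOpen_ne.mem_nhds hx] with t ht
    rw [phiMinus_of_ne_zero hlam ht]
    simp only [hNdef, hDdef, Pi.div_apply, hω]
  have hN : HasDerivAt N
      ((ω * 1 * Real.cos (ω * x) + ω * x * (-Real.sin (ω * x) * (ω * 1))) -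
        Real.cos (ω * x) * (ω * 1)) x := by
    have h1 : HasDerivAt (fun t : ℝ ↦ ω * t) (ω * 1) x := (hasDerivAt_id x).const_mul ω
    exact ((h1.mul h1.cos).sub h1.sin)
  have hD : HasDerivAt D (2 * π ^ 2 * (2 * x)) x := by
    simpa using (hasDerivAt_pow 2 x).const_mul (2 * π ^ 2)
  have hDx : D x ≠ 0 := by simp only [hDdef]; positivity
  have hQ := (hN.div hD hDx).ofReal_comp.const_mul I
  have hπ : (π : ℂ) ≠ 0 := by exact_mod_cast Real.pi_ne_zero
  have hx' : (x : ℂ) ≠ 0 := by exact_mod_cast hx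
  rw [hev.deriv_eq, hQ.deriv, phiMinus_of_ne_zero hlam hx]
  simp only [← hω, hNdef, hDdef]
  push_cast
  field_simp
  ring

/-- **The model data of `φ_-`** (`A = 0`, `B = iλ/π`): `x φ_-(x) − (iλ/π) cos ωx = −i sin(ωx)/(2π²x) → 0`
and `(φ_- + xφ_-′) + ω (iλ/π) sin ωx = −i(ωx cos ωx − sin ωx)/(2π²x²) → 0`.
[cite: ConnesMoscovici2022, Lemma 1.5 proof (= arXiv:2112.05500 chunk p0005:L94–L104)] -/
theorem phiMinus_model_tendsto (hlam : 0 < lam) :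
    Tendsto (fun x : ℝ ↦ (x : ℂ) * phiMinus lam x -
      (0 * (Real.sin (2 * π * lam * x) : ℂ) + (I * ((lam / π : ℝ) : ℂ)) * (Real.cos (2 * π * lam * x) : ℂ)))
      atTop (𝓝 0) ∧
    Tendsto (fun x : ℝ ↦ (phiMinus lam x + x * deriv (phiMinus lam) x) - ((2 * π * lam : ℝ) : ℂ) *
      (0 * (Real.cos (2 * π * lam * x) : ℂ) - (I * ((lam / π : ℝ) : ℂ)) * (Real.sin (2 * π * lam * x) : ℂ)))
      atTop (𝓝 0) := by
  have hπ : (π : ℂ) ≠ 0 := by exact_mod_cast Real.pi_ne_zero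
  have hπ0 : 0 < π := Real.pi_pos
  constructor
  · have hev : (fun x : ℝ ↦ (x : ℂ) * phiMinus lam x -
        (0 * (Real.sin (2 * π * lam * x) : ℂ) + (I * ((lam / π : ℝ) : ℂ)) *
          (Real.cos (2 * π * lam * x) : ℂ))) =ᶠ[atTop]
        fun x : ℝ ↦ -I * ((Real.sin (2 * π * lam * x) / (2 * π ^ 2 * x) : ℝ) : ℂ) := by
      filter_upwards [eventually_gt_atTop 0] with x hx
      have hx' : (x : ℂ) ≠ 0 := by exact_mod_cast hx.ne'
      rw [phiMinus_of_ne_zero hlam hx.ne']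
      push_cast
      field_simp
      ring
    refine Tendsto.congr' hev.symm ?_
    have hb : Tendsto (fun x : ℝ ↦ (2 * π ^ 2)⁻¹ * x⁻¹) atTop (𝓝 ((2 * π ^ 2)⁻¹ * 0)) :=
      tendsto_inv_atTop_zero.const_mul _
    rw [mul_zero] at hb
    refine squeeze_zero_norm' ?_ hb
    filter_upwards [eventually_gt_atTop 0] with x hx
    rw [norm_mul, norm_neg, Complex.norm_I, one_mul, Complex.norm_real, Real.norm_eq_abs, abs_div,
      abs_of_pos (by positivity : (0:ℝ) < 2 * π ^ 2 * x)]
    calc |Real.sin (2 * π * lam * x)| / (2 * π ^ 2 * x) ≤ 1 / (2 * π ^ 2 * x) := by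
          gcongr; exact Real.abs_sin_le_one _
      _ = (2 * π ^ 2)⁻¹ * x⁻¹ := by field_simp
  · have hev : (fun x : ℝ ↦ (phiMinus lam x + x * deriv (phiMinus lam) x) - ((2 * π * lam : ℝ) : ℂ) *
        (0 * (Real.cos (2 * π * lam * x) : ℂ) - (I * ((lam / π : ℝ) : ℂ)) *
          (Real.sin (2 * π * lam * x) : ℂ))) =ᶠ[atTop]
        fun x : ℝ ↦ -I * (((2 * π * lam * x * Real.cos (2 * π * lam * x) - Real.sin (2 * π * lam * x)) /
          (2 * π ^ 2 * x ^ 2) : ℝ) : ℂ) := by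
      filter_upwards [eventually_gt_atTop 0] with x hx
      have hx' : (x : ℂ) ≠ 0 := by exact_mod_cast hx.ne'
      rw [phiMinus_add_mul_deriv hlam hx.ne']
      push_cast
      field_simp
      ring
    refine Tendsto.congr' hev.symm ?_
    have hb : Tendsto (fun x : ℝ ↦ (2 * π * lam) / (2 * π ^ 2) * x⁻¹ + (2 * π ^ 2)⁻¹ * (x ^ 2)⁻¹)
        atTop (𝓝 ((2 * π * lam) / (2 * π ^ 2) * 0 + (2 * π ^ 2)⁻¹ * 0)) :=
      (tendsto_inv_atTop_zero.const_mul _).add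
        ((tendsto_inv_atTop_zero.comp (tendsto_pow_atTop two_ne_zero)).const_mul _)
    rw [mul_zero, mul_zero, add_zero] at hb
    refine squeeze_zero_norm' ?_ hb
    filter_upwards [eventually_gt_atTop 0] with x hx
    have hx2 : 0 < 2 * π ^ 2 * x ^ 2 := by positivity
    rw [norm_mul, norm_neg, Complex.norm_I, one_mul, Complex.norm_real, Real.norm_eq_abs, abs_div,
      abs_of_pos hx2]
    have hnum : |2 * π * lam * x * Real.cos (2 * π * lam * x) - Real.sin (2 * π * lam * x)| ≤
        2 * π * lam * x + 1 := by
      refine (abs_sub _ _).trans ?_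
      rw [abs_mul, abs_of_pos (by positivity : (0:ℝ) < 2 * π * lam * x)]
      have h1 : |Real.cos (2 * π * lam * x)| ≤ 1 := Real.abs_cos_le_one _
      have h2 : |Real.sin (2 * π * lam * x)| ≤ 1 := Real.abs_sin_le_one _
      have h3 : 2 * π * lam * x * |Real.cos (2 * π * lam * x)| ≤ 2 * π * lam * x :=
        mul_le_of_le_one_right (by positivity) h1
      linarith
    calc |2 * π * lam * x * Real.cos (2 * π * lam * x) - Real.sin (2 * π * lam * x)| /
          (2 * π ^ 2 * x ^ 2)
        ≤ (2 * π * lam * x + 1) / (2 * π ^ 2 * x ^ 2) := by gcongr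
      _ = (2 * π * lam) / (2 * π ^ 2) * x⁻¹ + (2 * π ^ 2)⁻¹ * (x ^ 2)⁻¹ := by
          field_simp

end PhiMinusModel

section DefectAtInfinity

variable {ξ₁ ξ₂ : L2R} {g₁ g₂ : ℝ → ℂ}

/-- **The symmetry defect as the limit of the Lagrange boundary form** (general limit): in the
setting of cc-t6's `inner_prolateMax_symm_of_tendsto_boundaryForm` (two elements of `dom W_max`
with regular representatives satisfying (1.19) one-sidedly and continuous up to `±λ`), if
`BF(R) − BF(−R) → L` as `R → +∞` then `⟪W_max ξ₁, ξ₂⟫ − ⟪ξ₁, W_max ξ₂⟫ = L` — eq. (1.7) with the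
middle brackets vanishing and the `±∞` brackets evaluated as a limit.
[cite: ConnesMoscovici2022, §1 eq. (1.7) and proof of Thm 1.6 (= arXiv:2112.05500 (2.7), chunks p0005:L31–L38, p0006:L81–L114)] -/
theorem inner_sub_inner_eq_of_tendsto_boundaryForm (hlam : 0 < lam)
    (hξ₁ : ξ₁ ∈ (prolateMax lam).domain) (hξ₂ : ξ₂ ∈ (prolateMax lam).domain)
    (hae₁ : ((ξ₁ : ℝ → ℂ)) =ᵐ[volume] g₁) (hg₁ : ContDiffOn ℝ 1 g₁ {x | x ≠ lam ∧ x ≠ -lam})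
    (hftc₁ : ∀ x y, x ≤ y → Icc x y ⊆ {x | x ≠ lam ∧ x ≠ -lam} →
      pCoeff lam y * deriv g₁ y - pCoeff lam x * deriv g₁ x =
        ∫ t in x..y, (qCoeff lam t * g₁ t - (prolateMax lam ⟨ξ₁, hξ₁⟩ : L2R) t))
    (hT₁ : ∀ a, a = lam ∨ a = -lam →
      Tendsto (fun x ↦ pCoeff lam x * deriv g₁ x) (𝓝[>] a) (𝓝 0) ∧
      Tendsto (fun x ↦ pCoeff lam x * deriv g₁ x) (𝓝[<] a) (𝓝 0))
    (hL₁ : ∀ a, a = lam ∨ a = -lam →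
      (∃ c, Tendsto g₁ (𝓝[>] a) (𝓝 c)) ∧ (∃ c, Tendsto g₁ (𝓝[<] a) (𝓝 c)))
    (hae₂ : ((ξ₂ : ℝ → ℂ)) =ᵐ[volume] g₂) (hg₂ : ContDiffOn ℝ 1 g₂ {x | x ≠ lam ∧ x ≠ -lam})
    (hftc₂ : ∀ x y, x ≤ y → Icc x y ⊆ {x | x ≠ lam ∧ x ≠ -lam} →
      pCoeff lam y * deriv g₂ y - pCoeff lam x * deriv g₂ x =
        ∫ t in x..y, (qCoeff lam t * g₂ t - (prolateMax lam ⟨ξ₂, hξ₂⟩ : L2R) t))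
    (hT₂ : ∀ a, a = lam ∨ a = -lam →
      Tendsto (fun x ↦ pCoeff lam x * deriv g₂ x) (𝓝[>] a) (𝓝 0) ∧
      Tendsto (fun x ↦ pCoeff lam x * deriv g₂ x) (𝓝[<] a) (𝓝 0))
    (hL₂ : ∀ a, a = lam ∨ a = -lam →
      (∃ c, Tendsto g₂ (𝓝[>] a) (𝓝 c)) ∧ (∃ c, Tendsto g₂ (𝓝[<] a) (𝓝 c)))
    {L : ℂ}
    (hinf : Tendsto (fun R ↦
        (star (g₁ R) * (pCoeff lam R * deriv g₂ R) - star (pCoeff lam R * deriv g₁ R) * g₂ R) -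
          (star (g₁ (-R)) * (pCoeff lam (-R) * deriv g₂ (-R)) -
            star (pCoeff lam (-R) * deriv g₁ (-R)) * g₂ (-R))) atTop (𝓝 L)) :
    ⟪(prolateMax lam ⟨ξ₁, hξ₁⟩ : L2R), ξ₂⟫_ℂ - ⟪ξ₁, (prolateMax lam ⟨ξ₂, hξ₂⟩ : L2R)⟫_ℂ = L := by
  set η₁' : L2R := (prolateMax lam ⟨ξ₁, hξ₁⟩ : L2R) with hη₁
  set η₂' : L2R := (prolateMax lam ⟨ξ₂, hξ₂⟩ : L2R) with hη₂
  have hFi : Integrable (fun t ↦ star ((η₁' : ℝ → ℂ) t) * g₂ t - star (g₁ t) * (η₂' : ℝ → ℂ) t) :=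
    integrable_F' (η₁ := η₁') (η₂ := η₂') hae₁ hae₂
  have hlim := intervalIntegral_tendsto_integral hFi tendsto_neg_atTop_atBot tendsto_id
  have hev : ∀ᶠ R : ℝ in atTop, ∫ t in (-R)..R,
      (star ((η₁' : ℝ → ℂ) t) * g₂ t - star (g₁ t) * (η₂' : ℝ → ℂ) t) =
      (star (g₁ R) * (pCoeff lam R * deriv g₂ R) - star (pCoeff lam R * deriv g₁ R) * g₂ R) -
        (star (g₁ (-R)) * (pCoeff lam (-R) * deriv g₂ (-R)) -
          star (pCoeff lam (-R) * deriv g₁ (-R)) * g₂ (-R)) := by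
    filter_upwards [eventually_gt_atTop lam] with R hR
    exact intervalIntegral_symm_eq_boundaryForm hlam hae₁ hg₁ hftc₁ hT₁ hL₁ hae₂ hg₂ hftc₂
      hT₂ hL₂ hR
  have hI : ∫ t, (star ((η₁' : ℝ → ℂ) t) * g₂ t - star (g₁ t) * (η₂' : ℝ → ℂ) t) = L :=
    tendsto_nhds_unique hlim (hinf.congr' (hev.mono fun R hR ↦ hR.symm))
  rw [← integral_F_eq_inner_sub (η₁ := η₁') (η₂ := η₂') hae₁ hae₂, hI]

/-- **The four one-sided (1.19)-limits of an element orthogonal to `β_±`.**  For `ζ ∈ dom W_max`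
with regular representative `g` (all the data of `exists_regular_repr`), orthogonality
`⟪W_max ζ, β_±⟫ = ⟪ζ, W_max β_±⟫` gives `p g′ → 0` one-sidedly at `±λ` from all four sides
(§B inner limits + §C lateral limits). [cite: ConnesMoscovici2022, proof of Thm 1.6, (2.16) (= arXiv:2112.05500 chunk p0006:L48–L50, L83–L85)] -/
theorem tendsto_four_sides_zero_of_orthogonal (hlam : 0 < lam) {ζ : L2R} {g : ℝ → ℂ}
    (hζ : ζ ∈ (prolateMax lam).domain)
    (hae : ((ζ : ℝ → ℂ)) =ᵐ[volume] g) (hg : ContDiffOn ℝ 1 g {x | x ≠ lam ∧ x ≠ -lam})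
    (hftc : ∀ x y, x ≤ y → Icc x y ⊆ {x | x ≠ lam ∧ x ≠ -lam} →
      pCoeff lam y * deriv g y - pCoeff lam x * deriv g x =
        ∫ t in x..y, (qCoeff lam t * g t - (prolateMax lam ⟨ζ, hζ⟩ : L2R) t))
    (hlims : ∀ a ∈ ({lam, -lam} : Set ℝ),
        (∃ c, Tendsto (fun x ↦ pCoeff lam x * deriv g x) (𝓝[>] a) (𝓝 c)) ∧
        (∃ c, Tendsto (fun x ↦ pCoeff lam x * deriv g x) (𝓝[<] a) (𝓝 c)))
    (hP : ⟪(prolateMax lam ⟨ζ, hζ⟩ : L2R), betaPlus lam hlam⟫_ℂ =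
      ⟪ζ, (prolateMax lam ⟨betaPlus lam hlam, (betaPlus_mem_prolateMax hlam).1⟩ : L2R)⟫_ℂ)
    (hM : ⟪(prolateMax lam ⟨ζ, hζ⟩ : L2R), betaMinus lam hlam⟫_ℂ =
      ⟪ζ, (prolateMax lam ⟨betaMinus lam hlam, (betaMinus_mem_prolateMax hlam).1⟩ : L2R)⟫_ℂ) :
    ∀ a, a = lam ∨ a = -lam →
      Tendsto (fun x ↦ pCoeff lam x * deriv g x) (𝓝[>] a) (𝓝 0) ∧
      Tendsto (fun x ↦ pCoeff lam x * deriv g x) (𝓝[<] a) (𝓝 0) := by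
  obtain ⟨⟨cLo, hcLo⟩, ⟨cL, hcL⟩⟩ := hlims lam (by simp)
  obtain ⟨⟨cR, hcR⟩, ⟨cRo, hcRo⟩⟩ := hlims (-lam) (by simp)
  obtain ⟨hL0, hR0⟩ := inner_limits_eq_zero hlam hζ hae hg hftc hcL hcR hP hM
  have e1 : cL = cLo := lateral_limits_eq_lam hlam hζ hae hg hftc hcL hcLo
  have e2 : cRo = cR := lateral_limits_eq_neg_lam hlam hζ hae hg hftc hcRo hcR
  intro a ha
  rcases ha with rfl | rfl
  · refine ⟨?_, ?_⟩
    · rw [← hL0, e1]; exact hcLo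
    · rw [← hL0]; exact hcL
  · refine ⟨?_, ?_⟩
    · rw [← hR0]; exact hcR
    · rw [← hR0, ← e2]; exact hcRo

end DefectAtInfinity

section DefectPairing

/-- **The symmetry defect against a vector of `𝓛_β` with an explicit `C¹` representative, as the
pairing of asymptotic coefficients.**  Let `ζ ∈ dom W_max` have regular representative `g` with
`p g′ → 0` from all four sides of `±λ` (e.g. `ζ ⊥ β_±`, `tendsto_four_sides_zero_of_orthogonal`),
even/odd parts with `+∞` model data `(A₁,B₁)`, `(A₁',B₁')`; let `τ ∈ 𝓛_β` have a global `C¹`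
representative `φ` whose even/odd parts have model data `(Aₑ,Bₑ)`, `(Aₒ,Bₒ)`.  Then
`⟪W_max ζ, τ⟫ − ⟪ζ, W_max τ⟫ = −2ω(conj B₁·Aₑ − conj A₁·Bₑ) − 2ω(conj B₁'·Aₒ − conj A₁'·Bₒ)`
("the terms coming from `±∞` do contribute", (1.7)–(1.8), evaluated by the known asymptotic form (1.18)).
[cite: ConnesMoscovici2022, §1 (1.7)–(1.8), Lemma 1.5, (1.18) (= arXiv:2112.05500 (2.7)–(2.8), (2.18), chunks p0005:L31–L44, L84–L110, p0006:L4–L30)] -/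
theorem inner_sub_inner_eq_pairing (hlam : 0 < lam) {ζ τ : L2R} {g φ : ℝ → ℂ}
    (hζ : ζ ∈ (prolateMax lam).domain)
    (hae : ((ζ : ℝ → ℂ)) =ᵐ[volume] g) (hg : ContDiffOn ℝ 1 g {x | x ≠ lam ∧ x ≠ -lam})
    (hftc : ∀ x y, x ≤ y → Icc x y ⊆ {x | x ≠ lam ∧ x ≠ -lam} →
      pCoeff lam y * deriv g y - pCoeff lam x * deriv g x =
        ∫ t in x..y, (qCoeff lam t * g t - (prolateMax lam ⟨ζ, hζ⟩ : L2R) t))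
    (hT : ∀ a, a = lam ∨ a = -lam →
      Tendsto (fun x ↦ pCoeff lam x * deriv g x) (𝓝[>] a) (𝓝 0) ∧
      Tendsto (fun x ↦ pCoeff lam x * deriv g x) (𝓝[<] a) (𝓝 0))
    {A₁ B₁ A₁' B₁' : ℂ}
    (hU₁ : Tendsto (fun x : ℝ ↦ (x : ℂ) * evenFn g x -
      (A₁ * (Real.sin (2 * π * lam * x) : ℂ) + B₁ * (Real.cos (2 * π * lam * x) : ℂ))) atTop (𝓝 0))
    (hV₁ : Tendsto (fun x : ℝ ↦ (evenFn g x + x * deriv (evenFn g) x) - ((2 * π * lam : ℝ) : ℂ) *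
      (A₁ * (Real.cos (2 * π * lam * x) : ℂ) - B₁ * (Real.sin (2 * π * lam * x) : ℂ))) atTop (𝓝 0))
    (hU₁' : Tendsto (fun x : ℝ ↦ (x : ℂ) * oddFn g x -
      (A₁' * (Real.sin (2 * π * lam * x) : ℂ) + B₁' * (Real.cos (2 * π * lam * x) : ℂ))) atTop (𝓝 0))
    (hV₁' : Tendsto (fun x : ℝ ↦ (oddFn g x + x * deriv (oddFn g) x) - ((2 * π * lam : ℝ) : ℂ) *
      (A₁' * (Real.cos (2 * π * lam * x) : ℂ) - B₁' * (Real.sin (2 * π * lam * x) : ℂ))) atTop (𝓝 0))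
    (hτ : τ ∈ prolateSASet lam) (hτφ : ((τ : ℝ → ℂ)) =ᵐ[volume] φ) (hφ : ContDiff ℝ 1 φ)
    {Ae Be Ao Bo : ℂ}
    (hUe : Tendsto (fun x : ℝ ↦ (x : ℂ) * evenFn φ x -
      (Ae * (Real.sin (2 * π * lam * x) : ℂ) + Be * (Real.cos (2 * π * lam * x) : ℂ))) atTop (𝓝 0))
    (hVe : Tendsto (fun x : ℝ ↦ (evenFn φ x + x * deriv (evenFn φ) x) - ((2 * π * lam : ℝ) : ℂ) *
      (Ae * (Real.cos (2 * π * lam * x) : ℂ) - Be * (Real.sin (2 * π * lam * x) : ℂ))) atTop (𝓝 0))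
    (hUo : Tendsto (fun x : ℝ ↦ (x : ℂ) * oddFn φ x -
      (Ao * (Real.sin (2 * π * lam * x) : ℂ) + Bo * (Real.cos (2 * π * lam * x) : ℂ))) atTop (𝓝 0))
    (hVo : Tendsto (fun x : ℝ ↦ (oddFn φ x + x * deriv (oddFn φ) x) - ((2 * π * lam : ℝ) : ℂ) *
      (Ao * (Real.cos (2 * π * lam * x) : ℂ) - Bo * (Real.sin (2 * π * lam * x) : ℂ))) atTop (𝓝 0)) :
    ⟪(prolateMax lam ⟨ζ, hζ⟩ : L2R), τ⟫_ℂ - ⟪ζ, (prolateMax lam ⟨τ, hτ.1⟩ : L2R)⟫_ℂ =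
      -2 * ((2 * π * lam : ℝ) : ℂ) * (star B₁ * Ae - star A₁ * Be) +
        -2 * ((2 * π * lam : ℝ) : ℂ) * (star B₁' * Ao - star A₁' * Bo) := by
  set U : Set ℝ := {x | x ≠ lam ∧ x ≠ -lam} with hU
  set η : L2R := prolateMax lam ⟨ζ, hζ⟩ with hη
  -- one-sided limits of `g` at `±λ` from (1.19)
  have hL : ∀ a, a = lam ∨ a = -lam →
      (∃ c, Tendsto g (𝓝[>] a) (𝓝 c)) ∧ (∃ c, Tendsto g (𝓝[<] a) (𝓝 c)) := by
    rintro a (rfl | rfl)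
    · exact ⟨exists_tendsto_right_lam_of_ftc hlam ζ η hae hg hftc (hT _ (Or.inl rfl)).1,
        exists_tendsto_left_lam_of_ftc hlam ζ η hae hg hftc (hT _ (Or.inl rfl)).2⟩
    · exact ⟨exists_tendsto_right_neg_lam_of_ftc hlam ζ η hae hg hftc (hT _ (Or.inr rfl)).1,
        exists_tendsto_left_neg_lam_of_ftc hlam ζ η hae hg hftc (hT _ (Or.inr rfl)).2⟩
  -- the regular representative of `τ` and its identification with `φ` off `{±λ}`
  obtain ⟨g₂, hae₂, hg₂, hftc₂, hT₂, hL₂, -, -⟩ := exists_regular_repr_bc_of_mem_prolateSASet hlam hτ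
  have heq : EqOn g₂ φ U :=
    eqOn_of_ae_eq_of_continuousOn (hae₂.symm.trans hτφ) hg₂.continuousOn hφ.continuous.continuousOn
  have hloc : ∀ R : ℝ, lam < R →
      (evenFn g₂ =ᶠ[𝓝 R] evenFn φ) ∧ (oddFn g₂ =ᶠ[𝓝 R] oddFn φ) := by
    intro R hR
    have hnb : ∀ᶠ x in 𝓝 R, lam < x := Ioi_mem_nhds hR
    constructor
    · filter_upwards [hnb] with x hx
      have h1 : x ∈ U := ⟨hx.ne', by intro h; linarith⟩
      have h2 : -x ∈ U := ⟨by intro h; linarith, fun h ↦ hx.ne' (neg_injective h)⟩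
      simp only [evenFn, heq h1, heq h2]
    · filter_upwards [hnb] with x hx
      have h1 : x ∈ U := ⟨hx.ne', by intro h; linarith⟩
      have h2 : -x ∈ U := ⟨by intro h; linarith, fun h ↦ hx.ne' (neg_injective h)⟩
      simp only [oddFn, heq h1, heq h2]
  -- the limit of the boundary form
  have hPe := tendsto_boundaryPairing_of_model lam hU₁ hV₁ hUe hVe
  have hPo := tendsto_boundaryPairing_of_model lam hU₁' hV₁' hUo hVo
  have hinf : Tendsto (fun R ↦
      (star (g R) * (pCoeff lam R * deriv g₂ R) - star (pCoeff lam R * deriv g R) * g₂ R) -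
        (star (g (-R)) * (pCoeff lam (-R) * deriv g₂ (-R)) -
          star (pCoeff lam (-R) * deriv g (-R)) * g₂ (-R))) atTop
      (𝓝 (-2 * ((2 * π * lam : ℝ) : ℂ) * (star B₁ * Ae - star A₁ * Be) +
        -2 * ((2 * π * lam : ℝ) : ℂ) * (star B₁' * Ao - star A₁' * Bo))) := by
    refine (hPe.add hPo).congr' ?_
    filter_upwards [eventually_gt_atTop lam] with R hR
    have hRU : R ∈ U := ⟨hR.ne', by intro h; linarith⟩
    obtain ⟨he, ho⟩ := hloc R hR
    rw [boundaryForm_sub_reflect_eq hg hg₂ hRU, he.deriv_eq, ho.deriv_eq, he.eq_of_nhds, ho.eq_of_nhds]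
    ring
  exact inner_sub_inner_eq_of_tendsto_boundaryForm hlam hζ hτ.1 hae hg hftc hT hL hae₂ hg₂ hftc₂
    hT₂ hL₂ hinf

end DefectPairing

/-! ## §E. Assembly: `𝓕(𝓛_β) ⊆ 𝓛_β` and `W_sa` commutes with `𝔽_{e_ℝ}` (Thm 1.6 (i), Fourier clause) -/

section Assembly

/-- `L²` functions are square-integrable on any set. [folklore] -/
private theorem integrableOn_sq_of_memLp'' {f : ℝ → ℂ} (hf : MemLp f 2 volume) (s : Set ℝ) :
    IntegrableOn (fun x ↦ ‖f x‖ ^ 2) s :=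
  ((memLp_two_iff_integrable_sq_norm hf.1).1 hf).integrableOn

/-- An `L²` class is interval integrable. [folklore] -/
private theorem intervalIntegrable_coe'' (η : L2R) (x y : ℝ) :
    IntervalIntegrable (fun t ↦ ((η : ℝ → ℂ)) t) volume x y :=
  (intervalIntegrable_iff').2
    ((((Lp.memLp η).locallyIntegrable (by norm_num)).integrableOn_isCompact isCompact_uIcc))

/-- **`Ω(𝓕ξ, τ) = 0` for `ξ ∈ 𝓛_β` and `𝓕⁻¹τ ∈ 𝓛_β`**: `Ω(𝓕ξ, τ) = Ω(ξ, 𝓕⁻¹τ)` (leaf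
`omegaForm_fourierL2_left`) and `Ω ≡ 0` on `𝓛_β × 𝓛_β` (cc-t6 `inner_prolateMax_symm`).
[cite: ConnesMoscovici2022, §1 eqs. (1.15)–(1.16) (= arXiv:2112.05500 (2.15)–(2.16), chunk p0006:L38–L50)] -/
theorem inner_prolateMax_fourierL2_eq (hlam : 0 < lam) {ξ τ : L2R} (hξ : ξ ∈ prolateSASet lam)
    (hτ : τ ∈ (prolateMax lam).domain) (hτ' : (𝓕⁻ τ : L2R) ∈ prolateSASet lam) :
    ⟪(prolateMax lam ⟨fourierL2 ξ, fourierL2_mem_prolateMax lam hξ.1⟩ : L2R), τ⟫_ℂ =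
      ⟪fourierL2 ξ, (prolateMax lam ⟨τ, hτ⟩ : L2R)⟫_ℂ := by
  have h := omegaForm_fourierL2_left lam ⟨ξ, hξ.1⟩ ⟨τ, hτ⟩
  have h0 : omegaForm lam ⟨ξ, hξ.1⟩ ⟨(𝓕⁻ τ : L2R), fourierInvL2_mem_prolateMax lam hτ⟩ = 0 := by
    unfold omegaForm
    rw [inner_prolateMax_symm hlam hξ hτ', sub_self, mul_zero]
  rw [h0] at h
  unfold omegaForm at h
  have hI : (-I : ℂ) ≠ 0 := neg_ne_zero.2 I_ne_zero
  have := (mul_eq_zero.1 h).resolve_left hI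
  exact sub_eq_zero.1 this

/-- The zero function has the trivial model data. [folklore] -/
private theorem model_zero (lam : ℝ) :
    Tendsto (fun x : ℝ ↦ (x : ℂ) * (fun _ : ℝ ↦ (0 : ℂ)) x -
      (0 * (Real.sin (2 * π * lam * x) : ℂ) + 0 * (Real.cos (2 * π * lam * x) : ℂ))) atTop (𝓝 0) ∧
    Tendsto (fun x : ℝ ↦ ((fun _ : ℝ ↦ (0 : ℂ)) x + x * deriv (fun _ : ℝ ↦ (0 : ℂ)) x) -
      ((2 * π * lam : ℝ) : ℂ) * (0 * (Real.cos (2 * π * lam * x) : ℂ) -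
        0 * (Real.sin (2 * π * lam * x) : ℂ))) atTop (𝓝 0) := by
  constructor
  · simp only [mul_zero, zero_mul, add_zero, sub_zero]; exact tendsto_const_nhds
  · simp only [deriv_const', mul_zero, zero_mul, add_zero, sub_zero]; exact tendsto_const_nhds

/-- `evenFn g` is even, `oddFn g` is odd. [folklore] -/
private theorem evenFn_neg' (g : ℝ → ℂ) (x : ℝ) : evenFn g (-x) = evenFn g x := by
  simp only [evenFn, neg_neg]; ring

/-- `oddFn g` is odd. [folklore] -/
private theorem oddFn_neg' (g : ℝ → ℂ) (x : ℝ) : oddFn g (-x) = -oddFn g x := by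
  simp only [oddFn, neg_neg]; ring

/-- One-sided limits at `a ∈ {±λ}` give the limit within `{x ≠ ±λ}`. [folklore] -/
private theorem tendsto_nhdsWithin_U_of_sides {f : ℝ → ℂ} {a : ℝ} (ha : a = lam ∨ a = -lam)
    (h₁ : Tendsto f (𝓝[>] a) (𝓝 0)) (h₂ : Tendsto f (𝓝[<] a) (𝓝 0)) :
    Tendsto f (𝓝[{x | x ≠ lam ∧ x ≠ -lam}] a) (𝓝 0) := by
  have hsub : {x : ℝ | x ≠ lam ∧ x ≠ -lam} ⊆ Iio a ∪ Ioi a := by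
    intro x hx
    rcases ha with rfl | rfl
    · exact (lt_or_gt_of_ne hx.1).elim (fun h ↦ Or.inl h) (fun h ↦ Or.inr h)
    · exact (lt_or_gt_of_ne hx.2).elim (fun h ↦ Or.inl h) (fun h ↦ Or.inr h)
  have h := h₂.sup h₁
  rw [← nhdsWithin_union] at h
  exact h.mono_left (nhdsWithin_mono a hsub)

/-- **The ANALYTIC converse of (1.15): orthogonality to the four test vectors forces the boundary
conditions.**  Let `ζ ∈ dom W_max` satisfy `⟪W_max ζ, τ⟫ = ⟪ζ, W_max τ⟫` for
`τ ∈ {β_+, β_-, 𝓕β_+, 𝓕β_-}`.  Then the regular representative of `ζ` satisfies (1.19) (§B–§C) and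
(1.20)/(1.21) (the `∞`-side pairing §D: the `cos`-coefficient of `ζ⁺` and the `sin`-coefficient of
`ζ⁻` vanish), so `ζ ∈ 𝓛_β` — eq. (1.15) `𝓛_β = ⋂ Ker L_{β±} ∩ ⋂ Ker L_{β̂±}` read from right to
left by boundary analysis of an ARBITRARY element of `dom W_max` (cc-t14 g4's
`mem_prolateSASet_of_omegaForm_betaQuad_eq_zero` in `UVProlateThm16Holds` reaches the same inclusion
algebraically through self-adjointness; the two proofs are independent).
[cite: ConnesMoscovici2022, §1 eq. (1.15) and Thm 1.6 (i) proof (= arXiv:2112.05500 (2.16), Thm 2.6, chunk p0006:L48–L50, L76–L85)] -/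
theorem mem_prolateSASet_of_inner_beta_eq (hlam : 0 < lam) {ζ : L2R}
    (hζ : ζ ∈ (prolateMax lam).domain)
    (hP : ⟪(prolateMax lam ⟨ζ, hζ⟩ : L2R), betaPlus lam hlam⟫_ℂ =
      ⟪ζ, (prolateMax lam ⟨betaPlus lam hlam, (betaPlus_mem_prolateMax hlam).1⟩ : L2R)⟫_ℂ)
    (hM : ⟪(prolateMax lam ⟨ζ, hζ⟩ : L2R), betaMinus lam hlam⟫_ℂ =
      ⟪ζ, (prolateMax lam ⟨betaMinus lam hlam, (betaMinus_mem_prolateMax hlam).1⟩ : L2R)⟫_ℂ)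
    (hFP : ⟪(prolateMax lam ⟨ζ, hζ⟩ : L2R), (𝓕 (betaPlus lam hlam) : L2R)⟫_ℂ =
      ⟪ζ, (prolateMax lam ⟨(𝓕 (betaPlus lam hlam) : L2R),
        (fourier_betaPlus_mem_prolateSASet hlam).1⟩ : L2R)⟫_ℂ)
    (hFM : ⟪(prolateMax lam ⟨ζ, hζ⟩ : L2R), (𝓕 (betaMinus lam hlam) : L2R)⟫_ℂ =
      ⟪ζ, (prolateMax lam ⟨(𝓕 (betaMinus lam hlam) : L2R),
        (fourier_betaMinus_mem_prolateSASet hlam).1⟩ : L2R)⟫_ℂ) :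
    ζ ∈ prolateSASet lam := by
  set η : L2R := prolateMax lam ⟨ζ, hζ⟩ with hηdef
  set U : Set ℝ := {x | x ≠ lam ∧ x ≠ -lam} with hU
  -- the regular representative and (1.19)
  obtain ⟨g, hae, hg, hftc, -, hlims⟩ := exists_regular_repr hlam ⟨ζ, hζ⟩
  have hT := tendsto_four_sides_zero_of_orthogonal hlam hζ hae hg hftc hlims hP hM
  -- `+∞` model data of the even / odd parts of `g`
  have hIoi : Ioi (lam + 1) ⊆ U := fun x hx ↦
    ⟨by intro h; simp only [mem_Ioi] at hx; linarith, by intro h; simp only [mem_Ioi] at hx; linarith⟩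
  have hIcc : ∀ x y : ℝ, lam + 1 < x → Icc x y ⊆ U :=
    fun x y hx t ht ↦ ⟨by intro h; linarith [ht.1], by intro h; linarith [ht.1]⟩
  have hmg : MemLp g 2 volume := (Lp.memLp ζ).ae_eq hae
  have hmη : MemLp (fun t ↦ ((η : ℝ → ℂ)) t) 2 volume := Lp.memLp η
  have hiη : ∀ a b, IntervalIntegrable (fun t ↦ ((η : ℝ → ℂ)) t) volume a b :=
    intervalIntegrable_coe'' η
  obtain ⟨A₁, B₁, hU₁, hV₁⟩ := exists_asymptotics_atTop_of_ftc hlam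
    ((contDiffOn_evenFn hg).mono hIoi)
    (fun x y hx hxy ↦ ftc_evenFn hg hftc hiη x y hxy (hIcc x y hx))
    (memLp_evenFn hmη).1.restrict (integrableOn_sq_of_memLp'' (memLp_evenFn hmη) _)
  obtain ⟨A₁', B₁', hU₁', hV₁'⟩ := exists_asymptotics_atTop_of_ftc hlam
    ((contDiffOn_oddFn hg).mono hIoi)
    (fun x y hx hxy ↦ ftc_oddFn hg hftc hiη x y hxy (hIcc x y hx))
    (memLp_oddFn hmη).1.restrict (integrableOn_sq_of_memLp'' (memLp_oddFn hmη) _)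
  -- the test vector `𝓕β_+ = φ_+` (even): the `cos`-coefficient `B₁` vanishes
  have heP : evenFn (phiPlus lam) = phiPlus lam := evenFn_eq_self_of_even (phiPlus_neg lam)
  have hoP : oddFn (phiPlus lam) = fun _ ↦ 0 := oddFn_eq_zero_of_even (phiPlus_neg lam)
  obtain ⟨hUe, hVe⟩ := phiPlus_model_tendsto hlam
  obtain ⟨hZ1, hZ2⟩ := model_zero lam
  have hpairP := inner_sub_inner_eq_pairing hlam hζ hae hg hftc hT hU₁ hV₁ hU₁' hV₁'
    (fourier_betaPlus_mem_prolateSASet hlam) (fourier_betaPlus_coeFn hlam)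
    (contDiff_phiPlus_nat lam 1) (Ae := ((1 / π : ℝ) : ℂ)) (Be := 0) (Ao := 0) (Bo := 0)
    (by rw [heP]; exact hUe) (by rw [heP]; exact hVe) (by rw [hoP]; exact hZ1) (by rw [hoP]; exact hZ2)
  rw [hFP, sub_self] at hpairP
  have hω : ((2 * π * lam : ℝ) : ℂ) ≠ 0 := Complex.ofReal_ne_zero.2 (by positivity)
  have hπ : ((1 / π : ℝ) : ℂ) ≠ 0 := Complex.ofReal_ne_zero.2 (by positivity)
  have h2ω : (-2 * ((2 * π * lam : ℝ) : ℂ)) ≠ 0 := mul_ne_zero (by norm_num) hω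
  have hB₁ : B₁ = 0 := by
    have h0 : (-2 * ((2 * π * lam : ℝ) : ℂ)) * (star B₁ * ((1 / π : ℝ) : ℂ)) = 0 := by
      linear_combination -hpairP
    have h1 : star B₁ * ((1 / π : ℝ) : ℂ) = 0 := (mul_eq_zero.1 h0).resolve_left h2ω
    have h2 : star B₁ = 0 := (mul_eq_zero.1 h1).resolve_right hπ
    simpa using congrArg star h2
  -- the test vector `𝓕β_- = φ_-` (odd): the `sin`-coefficient `A₁'` vanishes
  have heM : evenFn (phiMinus lam) = fun _ ↦ 0 := evenFn_eq_zero_of_odd (phiMinus_neg lam)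
  have hoM : oddFn (phiMinus lam) = phiMinus lam := oddFn_eq_self_of_odd (phiMinus_neg lam)
  obtain ⟨hUo, hVo⟩ := phiMinus_model_tendsto hlam
  have hpairM := inner_sub_inner_eq_pairing hlam hζ hae hg hftc hT hU₁ hV₁ hU₁' hV₁'
    (fourier_betaMinus_mem_prolateSASet hlam) (fourier_betaMinus_coeFn hlam)
    ((contDiff_phiMinus lam).of_le (by norm_num)) (Ae := 0) (Be := 0) (Ao := 0)
    (Bo := I * ((lam / π : ℝ) : ℂ))
    (by rw [heM]; exact hZ1) (by rw [heM]; exact hZ2) (by rw [hoM]; exact hUo) (by rw [hoM]; exact hVo)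
  rw [hFM, sub_self] at hpairM
  have hBo : I * ((lam / π : ℝ) : ℂ) ≠ 0 :=
    mul_ne_zero I_ne_zero (Complex.ofReal_ne_zero.2 (by positivity))
  have hA₁' : A₁' = 0 := by
    have h0 : (-2 * ((2 * π * lam : ℝ) : ℂ)) * (-(star A₁' * (I * ((lam / π : ℝ) : ℂ)))) = 0 := by
      linear_combination -hpairM
    have h1 : star A₁' * (I * ((lam / π : ℝ) : ℂ)) = 0 :=
      neg_eq_zero.1 ((mul_eq_zero.1 h0).resolve_left h2ω)
    have h2 : star A₁' = 0 := (mul_eq_zero.1 h1).resolve_right hBo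
    simpa using congrArg star h2
  -- the boundary conditions
  have hEtop : Tendsto (bcInfEven lam (evenFn g)) atTop (𝓝 0) := by
    have := tendsto_bcInfEven_of_model lam hU₁ hV₁
    rwa [hB₁, mul_zero, neg_zero] at this
  have hOtop : Tendsto (bcInfOdd lam (oddFn g)) atTop (𝓝 0) := by
    have := tendsto_bcInfOdd_of_model lam hU₁' hV₁'
    rwa [hA₁', mul_zero] at this
  refine ⟨hζ, g, hae, ⟨hg.differentiableOn one_ne_zero, ?_, ?_, hEtop, ?_, hOtop, ?_⟩⟩
  · exact tendsto_nhdsWithin_U_of_sides (Or.inl rfl) (hT lam (Or.inl rfl)).1 (hT lam (Or.inl rfl)).2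
  · exact tendsto_nhdsWithin_U_of_sides (Or.inr rfl) (hT (-lam) (Or.inr rfl)).1
      (hT (-lam) (Or.inr rfl)).2
  · exact tendsto_atBot_zero_of_odd (bcInfEven_neg_of_even lam (evenFn_neg' g)) hEtop
  · exact tendsto_atBot_zero_of_odd (bcInfOdd_neg_of_odd lam (oddFn_neg' g)) hOtop

end Assembly

end Literature.NumberTheory.ConnesMoscovici2022

end
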